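import Summits.HodgeConjecture.HodgeConjecture.Theses.EndoscopicMiddleDegree
import Summits.HodgeConjecture.HodgeConjecture.Theorems.EndoscopicMiddleDegreeMiddleThetaSpanHeckeIdempotents
import Literature.AlgebraicGeometry.ShimuraVarieties.HeckeCorrespondenceAction
import Literature.AlgebraicGeometry.HodgeTheory.ComplexGysinCorrespondence
import Literature.AlgebraicGeometry.HodgeTheory.ComplexGysinHodgeType
import Literature.AlgebraicGeometry.HodgeTheory.ComplexConjugationHolds
import Literature.AlgebraicGeometry.HodgeTheory.GysinBaseChange
import Literature.AlgebraicGeometry.HodgeTheory.HodgeFiltrationModelsReductionProofs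
import Literature.AlgebraicGeometry.HodgeTheory.HodgeTypeConjugation
import Literature.AlgebraicGeometry.HodgeTheory.HodgeTypePullback
import Literature.AlgebraicGeometry.HodgeTheory.SupportedHodgeClassDescent
import Literature.AlgebraicGeometry.HodgeTheory.RationalClassesRingChange
import Literature.AlgebraicGeometry.HodgeTheory.SupportedClassesRationalProofs
import Literature.AlgebraicGeometry.HodgeTheory.VanishingCohomologyNontrivialProofs
import Literature.AlgebraicTopology.SingularHomology.GysinMapSupportProofs
import Literature.AlgebraicTopology.SingularHomology.CohomologyRingChangeFunctoriality
import Literature.AlgebraicTopology.SingularHomology.IntegralClassRingChange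
import Literature.NumberTheory.Transcendental.DeRhamTheoremMultiplicative

/-!
# Line `middle-involution-purity` — LEAD's reshaped skeleton, rev L1 (second lead lineage, seat c1, cycle 1, 2026-08-16)

RESHAPE (lead, cycle 1; the planner's round-1 text follows unchanged below this block).
(R1) `stub_archDictionary` is DERIVED, not a stub: as typed, its exact archimedean data are satisfied
by the all-singleton composition `b ≡ 1` on the `2n+1` slots with `S` = the set of degree-`2n` Hodge
types OCCURRING in `range z` — clause (3) is the Hodge decomposition `c = z c' = Σ z c'_{pq}` once `z`
preserves every Hodge type, clause (4) is the definition of `S`. So the dictionary reduces to the NEW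
registered stub `stub_archDataOfHodgeStable` (pure Hodge-decomposition bookkeeping, hypothesis: `z`
preserves all types) composed with `heckeHodgeType` (the Hecke algebra preserves every Hodge type — from
`stub_heckePushPull` and the tree's PROVED Gysin/pull-back Hodge calculus, verbatim the sibling line's
derivation). FINDING (for the planners): the written-out ArchData conjunction does not pin Arthur's
data, hence the census cut `slotPurity_of_archData` constrains nothing at the type level and
`stub_coreVanishingArch` (renamed from `stub_coreVanishing`; signature unchanged) is instantiated for
EVERY impure ℂ-block meeting `H^{n,n}` — it is the sibling line's bet plus the sieve case.
(R2) `stub_sieveKill` is DERIVED (`sieveKill`) from: Hodge-type stability (`heckeHodgeType`), the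
directness of the Hodge decomposition (`typeKill`, proved here), and the ℚ-DESCENT LEMMA
`rationalBlockDescent` (proved here: a non-zero central idempotent `z ≤ ε` of the Hecke algebra that
kills a RATIONAL class forces the whole ℚ-block `ε` to kill it — the coefficient-conjugation sieve in
its strong form, with NO `Aut(ℂ)`-orbit argument: descent of the centre + a ℚ-side Fitting idempotent
+ primitivity of `ε`), which rests on three NEW registered algebra stubs: `stub_rationalRelations`
(ℂ-linear relations among rational classes are spanned by ℚ-relations), `stub_ratSpannedInf`
(intersections of ℚ-spanned subspaces of `ℂ^N` are ℚ-spanned; Mathlib-only) and `stub_rationalFitting`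
(a rational-preserving non-nilpotent operator has a non-zero idempotent among its ℚ-polynomial
multiples). Registered stubs of this line after the reshape (7): `stub_heckePushPull`, `stub_cupTriple`
(shared, byte-identical with the sibling line `purity-sorted-hecke-envelope`, in ITS wave),
`stub_archDataOfHodgeStable`, `stub_rationalRelations`, `stub_ratSpannedInf`, `stub_rationalFitting`
(new, provable now), `stub_coreVanishingArch` (THE BET; HC-strength; held, not attacked by proof).

# Line `middle-involution-purity` for crux `EndoscopicMiddleDegree.OrthogonalEnveloped`
# (stmt-HodgeConjecture-14300) — planner's checked skeleton (crux-plan, round 1)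

THE CRUX (rank 4, the automorphic heart of route EndoscopicMiddleDegree): for an orientation family `μ`
with Poincaré duality, `m ∈ {1,2}` (`n = m + 1`, `dim X = 2n`, `N = 2n + 1 ∈ {5,7}`), a datum
`D : UnitaryBallQuotientDatum (2n) X` and a RATIONAL class `e ∈ H²ⁿ(X(ℂ); ℂ)` of Hodge type `(n,n)`
cup-orthogonal to the theta world `TW(D)`, there is `γ ∈ algebraicClasses (X ⊗ X) (2n)` whose action
`P_γ β = pr₁₊(pr₂^* β ∪ γ)` (the tree's `corrAction μ hX hX rfl γ`, `rfl`) preserves rational classes,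
has purely `(n,n)` image and fixes `e`.

THE LINE (idea card `Ideas/middle-involution-purity.md`, triage r1-1/r1-2: pass). The envelope is the
picked Hecke envelope (line `IdeatorThreeSketch` = card `impure-barren-envelope`): `H = H²ⁿ(X(ℂ); ℂ)`,
`𝓗 = Algebra.adjoin ℂ (range (D.heckeCorrespondenceAction (2n)))`, its ℚ-BLOCKS `ε` (central idempotents
of `𝓗` preserving rational classes, primitive among such; `stub_rationalBlocks`, LANDED p87916, here
`rationalBlocks_landed`), each the
action `P_γ` of an ALGEBRAIC class (`stub_heckePushPull` + `stub_corrAlgebra` (LANDED p91059, here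
`corrAlgebra_landed`) + `stub_cupTriple`, composition `heckeGraphAlgebraic`), and `γ := Σ_{ε pure} γ_ε`. What is NEW is the proof
that an IMPURE ℚ-block kills `e` — the picked line's single automorphic stub `stub_impureBarren` is here
DERIVED (`impure_rationalBlock_apply_eq_zero`) from three finer statements through the card's lever:

* `stub_archDictionary` (the ONE paper input of the card, an INTERFACE/CONSTRUCTION statement): every
  ℂ-block `z` of `𝓗` (primitive central idempotent; automorphically one near-equivalence class `π_f` up
  to twists by characters of `π₀`) carries EXACT ARCHIMEDEAN BLOCK DATA `(b, S)`: a composition `b` of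
  the `N = 2n+1` infinitesimal-character slots `{n, …, -n}` at `τ₁` into consecutive blocks (one block per
  (constituent, weight) of the Arthur parameter `ψ(π_f)`), and the set `S` of blocks of ONE constituent
  `μ` (the one selected by the `S_ψ`-character of `π_f`: Arthur's multiplicity formula, Mok / KMSW, with
  the Adams–Johnson sign rule "member `π_B` differs from the base point exactly at the generator of the
  constituent owning `B`", AdJo Thm 2.21 as transported by Arancibia–Moeglin–Renard Thm 1.1/§8), all of
  the same size, such that the Hodge types occurring in `z(H)` are EXACTLY the degree-`2n`
  Vogan–Zuckerman types `(R⁺_B + j, R⁻_B + j)` of the members `π_B`, `B ∈ S` (`ajTypes`, `ajTypesOf`).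
* `slotPurity_of_archData` (PROVED here; the card's first lemma `nn_mem_ajTypes_iff` + the `N ≤ 7`
  census `census_size_one`): exact data force the trichotomy PURE `(n,n)` (`S = {B₀}`, `B₀` centred) /
  KILLED (no centred block in `S`: the types of `z(H)` avoid `(n,n)`) / TEMPERED-TYPE CORE (`|S| ≥ 2`,
  `B₀ ∈ S`, and then — census, this is where `m ≤ 2` is used — ALL blocks of `S` are singletons:
  `μ = Ψ_d ⊠ R₁ ∋ 0`, `d ≥ 2`, the closed list of Disproof F5b). In particular the crux text's fear "at
  `m = 2` a non-DS Adams–Johnson member sharing `π_f` could make the CAP piece impure in `H⁶`" is void: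
  a piece meeting `H^{n,n}` is impure only if it is a tempered-type core.
* `stub_sieveKill` (AH-free, provable in principle: the coefficient-conjugation sieve of the landed
  `stub_sieve` of crux MiddleThetaSpan, in ℚ-block form): a ℚ-block having a non-zero ℂ-sub-block whose
  image avoids the type `(n,n)` kills every RATIONAL `(n,n)`-class.
* `stub_coreVanishing` (THE BET, = the route's CoreVanishing = Disproof F5 NoImpureRationalComponents,
  now restricted to tempered-type cores with their exact singleton data): a ℚ-block having a
  tempered-type core ℂ-sub-block kills every rational `(n,n)`-class `e ⊥ TW(D)`. HC-strength (Disproof F1/F5: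
  implied by HC + Tate on the sector, by nothing less in print; irrefutable short of `¬HC`).

`OrthogonalEnveloped_of` is the kernel-checked composition (the envelope bookkeeping is the picked line's,
verbatim). Disproof honoured: the two `_false_without_` theorems of `Cruxes/OrthogonalEnveloped/Disproof.lean`
(F4: `withoutHodgeType_false_of_hasTranscendentalOrthClass`, `withoutRational_false_of_hasNonRationalSpanOrthClass`)
— the line uses `IsRationalClass e` AND `IsOfHodgeType e` at `stub_sieveKill` and at `stub_coreVanishing`;
`e ⊥ TW(D)` is kept verbatim in `stub_coreVanishing` (F4/F7: not load-bearing for truth; keeps the stub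
≤ crux strength). Landed Negative lemma `Negative/EnvelopeOfAlgebraic` (F1: crux ⟸ HC) refutes no stub.

Registered stubs (5): `stub_heckePushPull`, `stub_cupTriple` — shared infrastructure, BYTE-IDENTICAL with line
`IdeatorThreeSketch` (one proof closes both lines' stub); `stub_archDictionary`, `stub_sieveKill`,
`stub_coreVanishing` — new. The picked line's two LANDED stubs (`stub_corrAlgebra` p91059,
`stub_rationalBlocks` p87916) are PROVED here as `corrAlgebra_landed` / `rationalBlocks_landed` (proofs inlined
verbatim from the landed Theorems files; replace by imports once the farm serves those modules). Hardest:
`stub_coreVanishing` (truth: HC-strength); `stub_archDictionary` is the Literature-grade construction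
(Arthur's classification at `τ₁`), XL in Lean, true on paper modulo the route-wide standing hypotheses.

VOCABULARY: only the two Finset-valued combinatorial definitions `ajTypes`, `ajTypesOf` (section
"Vocabulary") enter stub signatures; copy them VERBATIM into the Theorems file that closes
`stub_archDictionary` / `stub_coreVanishing` (same namespace). The exact archimedean data are a written-out
CONJUNCTION (no Summits-side `Prop` definition, D-0027 §2.1).
-/

noncomputable section

-- The crux-workfile namespace `Summit.<P>.<Sub>.Cruxes.…` repeats `HodgeConjecture` (single-conjunct summit).
set_option linter.dupNamespace false

namespace Summit.HodgeConjecture.HodgeConjecture.Cruxes.OrthogonalEnveloped.MiddleInvolutionPurity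

open scoped BigOperators
open CategoryTheory MonoidalCategory CartesianMonoidalCategory
open Literature.AlgebraicGeometry.Motives (SchemeOver ComplexPoints IsSmoothProjective)
open Literature.AlgebraicGeometry.Motives (IsSmoothProjective.tensor_holds)
open Literature.AlgebraicGeometry.HodgeTheory
open Literature.AlgebraicGeometry.ShimuraVarieties
open Literature.AlgebraicTopology.SingularHomology
open Summit.HodgeConjecture.HodgeConjecture.Theses.EndoscopicMiddleDegree
  (OrthogonalEnveloped)
open Summit.HodgeConjecture.HodgeConjecture.Cruxes.MiddleThetaSpan.ConjugateDimensionSieve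
  (IsCentralIdempotent IsPrimitiveCentralIdempotent exists_primitiveCentralIdempotents)

/-! ## Vocabulary (copy VERBATIM into the closing Theorems file) -/

/-- **Vogan–Zuckerman bidegrees of an Adams–Johnson member, as block combinatorics** (card
`middle-involution-purity`, first lemma; verbatim from `IdeatorOneSketch.lean`). For a composition
`b : Fin r → ℕ` of the `2n+1` infinitesimal-character slots (top to bottom) into consecutive blocks and
the packet member whose NON-COMPACT factor `U(bᵢ−1,1)` sits in block `i`: its `(𝔤,K)`-cohomology with
trivial coefficients has Hodge bidegrees `(R⁺ + j, R⁻ + j)`, `0 ≤ j < b i`, where `R⁺ = #slots above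
block i`, `R⁻ = #slots below` (`R^± = dim 𝔲 ∩ 𝔭^±`, then the cohomology of the compact dual `ℙ^{bᵢ−1}`).
[cite: arXiv:1306.1515, §2.2 and §5] -/
def ajTypes {r : ℕ} (b : Fin r → ℕ) (i : Fin r) : Finset (ℕ × ℕ) :=
  (Finset.range (b i)).image fun j ↦
    ((∑ k ∈ Finset.univ.filter (· < i), b k) + j, (∑ k ∈ Finset.univ.filter (i < ·), b k) + j)

/-- The degree-`k` bidegrees of the members at the blocks of `S`. [cite: arXiv:1306.1515, §5] -/
def ajTypesOf {r : ℕ} (b : Fin r → ℕ) (S : Finset (Fin r)) (k : ℕ) : Finset (ℕ × ℕ) :=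
  (S.biUnion fun i ↦ ajTypes b i).filter fun pq ↦ pq.1 + pq.2 = k

/-! ### Exact archimedean block data (a CONJUNCTION, deliberately not a named `Prop` definition)

`ArchData(m, X, z, b, S)` below always denotes the following conjunction, written out in full wherever it
occurs (stub signatures must not depend on a Summits-side `Prop` definition, D-0027 §2.1):
`(∑ k, b k = 2(m+1)+1)` — the blocks tile the infinitesimal-character slots `{n,…,-n}`, `n = m+1`;
`(∀ i ∈ S, ∀ j ∈ S, b i = b j)` — the selected blocks (those of ONE constituent) have equal size;
`range z ≤ span {c | ∃ pq ∈ ajTypesOf b S (2(m+1)), c of type pq}` — the image of `z` is spanned by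
classes of the degree-`2(m+1)` Vogan–Zuckerman types of the members at the blocks of `S`;
`∀ pq ∈ ajTypesOf b S (2(m+1)), ∃ c ∈ range z, c ≠ 0 ∧ c of type pq` — each listed type OCCURS.
Intended meaning: `z` a ℂ-block of the Hecke algebra on `H^{2(m+1)}(X(ℂ); ℂ)`, `b` the block
composition at `τ₁` of the Arthur parameter of its `π_f`, `S` the blocks of the constituent selected by
the `S_ψ`-character of `π_f` (AMR arXiv:1507.01432 Thm 1.1/§8; Adams–Johnson Thm 2.21; Mok/KMSW). -/


/-! ## Block combinatorics (PROVED): the card's first lemma and the `N ≤ 7` census -/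

/-- **Type `(n,n)` occurs exactly for the CENTRED block** (as many slots above as below), and then
`2 R⁺ + b i = 2n + 1` (card `middle-involution-purity`, first lemma, verbatim from `IdeatorOneSketch`).
[cite: arXiv:1306.1515, §5] -/
theorem nn_mem_ajTypes_iff {r : ℕ} (b : Fin r → ℕ) (i : Fin r) (n : ℕ)
    (hN : ∑ k, b k = 2 * n + 1) :
    (n, n) ∈ ajTypes b i ↔
      (∑ k ∈ Finset.univ.filter (· < i), b k) = ∑ k ∈ Finset.univ.filter (i < ·), b k ∧
        2 * (∑ k ∈ Finset.univ.filter (· < i), b k) + b i = 2 * n + 1 := by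
  classical
  set Rp := ∑ k ∈ Finset.univ.filter (· < i), b k with hRp
  set Rm := ∑ k ∈ Finset.univ.filter (i < ·), b k with hRm
  -- the slots split as (above block i) + (block i) + (below block i)
  have hsplit : ∑ k, b k = Rp + (b i + Rm) := by
    rw [← Finset.sum_filter_add_sum_filter_not Finset.univ (· < i)]
    congr 1
    have hset : Finset.univ.filter (fun k : Fin r ↦ ¬ k < i) =
        insert i (Finset.univ.filter (i < ·)) := by
      ext k
      simp only [Finset.mem_filter, Finset.mem_univ, true_and, Finset.mem_insert, not_lt]
      constructor
      · intro h
        rcases eq_or_lt_of_le h with h | h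
        · exact Or.inl h.symm
        · exact Or.inr h
      · rintro (rfl | h)
        · exact le_rfl
        · exact le_of_lt h
    rw [hset, Finset.sum_insert (by simp)]
  rw [hN] at hsplit
  constructor
  · intro h
    obtain ⟨j, hj, hjn⟩ := Finset.mem_image.mp h
    simp only [Prod.mk.injEq] at hjn
    obtain ⟨h1, h2⟩ := hjn
    refine ⟨by omega, by omega⟩
  · rintro ⟨h1, h2⟩
    refine Finset.mem_image.mpr ⟨n - Rp, Finset.mem_range.mpr (by omega), ?_⟩
    simp only [Prod.mk.injEq]
    exact ⟨by omega, by omega⟩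

/-- **A centred block contributes ONLY the type `(n,n)` in degree `2n`**: every degree-`2n` type of the
member at a block carrying `(n,n)` is `(n,n)` (the types of one member have pairwise distinct degrees).
[cite: arXiv:1306.1515, §5] -/
theorem eq_nn_of_mem_ajTypes_of_centred {r : ℕ} {b : Fin r → ℕ} {i : Fin r} {n : ℕ}
    (hi : (n, n) ∈ ajTypes b i) {pq : ℕ × ℕ} (hpq : pq ∈ ajTypes b i)
    (hdeg : pq.1 + pq.2 = 2 * n) : pq = (n, n) := by
  classical
  obtain ⟨j₀, -, hj₀⟩ := Finset.mem_image.mp hi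
  obtain ⟨j, -, hj⟩ := Finset.mem_image.mp hpq
  simp only [Prod.mk.injEq] at hj₀
  obtain ⟨h1, h2⟩ := hj₀
  subst hj
  simp only at hdeg
  simp only [Prod.mk.injEq]
  exact ⟨by omega, by omega⟩

/-- **The `N ≤ 7` census** (card `middle-involution-purity` (2); Disproof F5b; re-derived by both
triagers): if the centred block `i₀` (the one carrying `(n,n)`, `n = m + 1`) has a partner `j ≠ i₀` of
the SAME size among `2(m+1)+1 ≤ 7` slots, that size is `1` — a centred block of odd size `b₀` leaves
`(N - b₀)/2` slots on each side, so a partner needs `3 b₀ ≤ N`, i.e. `b₀ = 1` for `N ∈ {5, 7}` (at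
`N = 9` the size-3 cores `μ ⊠ R₃`, `dim μ ≥ 2`, appear: the guard `m ≤ 2` is used exactly here).
[cite: arXiv:1306.1515, §5] -/
theorem census_size_one {r : ℕ} {b : Fin r → ℕ} {m : ℕ} (hm : m ≤ 2)
    (hN : ∑ k, b k = 2 * (m + 1) + 1) {i₀ j : Fin r} (hi₀ : (m + 1, m + 1) ∈ ajTypes b i₀)
    (hj : j ≠ i₀) (hbj : b j = b i₀) : b i₀ = 1 := by
  classical
  obtain ⟨hR, h2⟩ := (nn_mem_ajTypes_iff b i₀ (m + 1) hN).1 hi₀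
  rcases lt_or_gt_of_ne hj with hlt | hgt
  · -- `j` lies above `i₀`: `b j ≤ R⁺`
    have hle : b j ≤ ∑ k ∈ Finset.univ.filter (· < i₀), b k :=
      Finset.single_le_sum (f := b) (fun _ _ ↦ Nat.zero_le _)
        (Finset.mem_filter.2 ⟨Finset.mem_univ _, hlt⟩)
    omega
  · -- `j` lies below `i₀`: `b j ≤ R⁻ = R⁺`
    have hle : b j ≤ ∑ k ∈ Finset.univ.filter (i₀ < ·), b k :=
      Finset.single_le_sum (f := b) (fun _ _ ↦ Nat.zero_le _)
        (Finset.mem_filter.2 ⟨Finset.mem_univ _, hgt⟩)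
    omega

/-- Membership in `ajTypesOf`. [folklore] -/
theorem mem_ajTypesOf {r : ℕ} {b : Fin r → ℕ} {S : Finset (Fin r)} {k : ℕ} {pq : ℕ × ℕ} :
    pq ∈ ajTypesOf b S k ↔ (∃ i ∈ S, pq ∈ ajTypes b i) ∧ pq.1 + pq.2 = k := by
  simp [ajTypesOf, Finset.mem_filter, Finset.mem_biUnion]

/-- The classes of one Hodge type `(a, b)` form a subspace (a Hodge model `A` supplies `0`).
[cite: VoisinHodgeI2002, §7.1.1] -/
def hodgeTypeClasses {N : ℕ} {X : SchemeOver ℂ} (hX : IsSmoothProjective N X) (A : HodgeModel N X)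
    (k a b : ℕ) : Submodule ℂ (complexBetti X k) where
  carrier := {c | IsOfHodgeType N X k a b c}
  add_mem' ha hb := ha.add hX hb
  zero_mem' := IsOfHodgeType.zero A k a b
  smul_mem' t _ hc := hc.smul t

/-- **SLOT PURITY from exact archimedean data (PROVED; the card's MiddleCharacterPurity + census).**
If `z` carries exact block data `(b, S)` on `2(m+1)+1 ≤ 7` slots then EITHER the image of `z` is purely
of type `(n,n)` (`S = {B₀}`, `B₀` centred: the constituent owning the middle slot is a character /
one-dimensional — Tate type in the wide sense, CAP or not, visible or not), OR the image of `z` is spanned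
by classes of finitely many types all `≠ (n,n)` (no centred block in `S`: KILLED), OR `z` is a
TEMPERED-TYPE CORE: `|S| ≥ 2`, the centred block lies in `S`, and ALL blocks of `S` are singletons
(`μ = Ψ_d ⊠ R₁ ∋ 0`, `d = |S| ≥ 2`). [cite: arXiv:1306.1515, §5] [cite: arXiv:1507.01432, Thm 1.1] -/
theorem slotPurity_of_archData {m : ℕ} {X : SchemeOver ℂ} (hX : IsSmoothProjective (2 * (m + 1)) X)
    (A : HodgeModel (2 * (m + 1)) X) (hm : m ≤ 2)
    {z : Module.End ℂ (complexBetti X (2 * (m + 1)))} {r : ℕ} {b : Fin r → ℕ} {S : Finset (Fin r)}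
    (h : ((∑ k, b k = 2 * (m + 1) + 1) ∧ (∀ i ∈ S, ∀ j ∈ S, b i = b j) ∧
      LinearMap.range z ≤ Submodule.span ℂ {c : complexBetti X (2 * (m + 1)) |
        ∃ pq ∈ ajTypesOf b S (2 * (m + 1)), IsOfHodgeType (2 * (m + 1)) X (2 * (m + 1)) pq.1 pq.2 c} ∧
      ∀ pq ∈ ajTypesOf b S (2 * (m + 1)), ∃ c ∈ LinearMap.range z, c ≠ 0 ∧
        IsOfHodgeType (2 * (m + 1)) X (2 * (m + 1)) pq.1 pq.2 c)) :
    (∀ β, IsOfHodgeType (2 * (m + 1)) X (2 * (m + 1)) (m + 1) (m + 1) (z β)) ∨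
    (∃ T : Finset (ℕ × ℕ), (m + 1, m + 1) ∉ T ∧
      LinearMap.range z ≤ Submodule.span ℂ {c : complexBetti X (2 * (m + 1)) |
        ∃ pq ∈ T, IsOfHodgeType (2 * (m + 1)) X (2 * (m + 1)) pq.1 pq.2 c}) ∨
    (2 ≤ S.card ∧ (∀ i ∈ S, b i = 1) ∧ ∃ i₀ ∈ S, (m + 1, m + 1) ∈ ajTypes b i₀) := by
  classical
  obtain ⟨hN, hsize, hrange, -⟩ := h
  by_cases hc : ∃ i₀ ∈ S, (m + 1, m + 1) ∈ ajTypes b i₀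
  · obtain ⟨i₀, hi₀S, hi₀⟩ := hc
    by_cases hS : ∃ j ∈ S, j ≠ i₀
    · -- a partner block in the selected constituent: tempered-type core by the census
      obtain ⟨j, hjS, hj⟩ := hS
      have hb1 : b i₀ = 1 := census_size_one hm hN hi₀ hj (hsize j hjS i₀ hi₀S)
      refine Or.inr (Or.inr ⟨?_, fun i hi ↦ (hsize i hi i₀ hi₀S).trans hb1, i₀, hi₀S, hi₀⟩)
      exact Finset.one_lt_card.2 ⟨j, hjS, i₀, hi₀S, hj⟩
    · -- `S = {B₀}` with `B₀` centred: every type of the image is `(n,n)`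
      push Not at hS
      refine Or.inl fun β ↦ ?_
      have key : Submodule.span ℂ {c : complexBetti X (2 * (m + 1)) |
            ∃ pq ∈ ajTypesOf b S (2 * (m + 1)), IsOfHodgeType (2 * (m + 1)) X (2 * (m + 1)) pq.1 pq.2 c} ≤
          hodgeTypeClasses hX A (2 * (m + 1)) (m + 1) (m + 1) := by
        refine Submodule.span_le.2 ?_
        rintro c ⟨pq, hpq, hcpq⟩
        obtain ⟨⟨i, hiS, hpqi⟩, hdeg⟩ := mem_ajTypesOf.1 hpq
        rw [hS i hiS] at hpqi
        rw [eq_nn_of_mem_ajTypes_of_centred hi₀ hpqi hdeg] at hcpq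
        exact hcpq
      exact key (hrange (LinearMap.mem_range_self z β))
  · -- no centred block in `S`: the image avoids `(n,n)`
    push Not at hc
    refine Or.inr (Or.inl ⟨ajTypesOf b S (2 * (m + 1)), fun hmem ↦ ?_, hrange⟩)
    obtain ⟨⟨i, hiS, hi⟩, -⟩ := mem_ajTypesOf.1 hmem
    exact hc i hiS hi

/-! ## Landed infrastructure of the picked line (PROVED; inlined verbatim from the landed Theorems files,
namespace `…ImpureBarrenEnvelope`, until the farm serves those modules to crux workfiles) -/

theorem gysinDiagonal_one_mem_algebraicClasses (μ : OrientationFamily) (hμ : μ.HasPoincareDuality)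
    {n : ℕ} {X : SchemeOver ℂ} (hX : IsSmoothProjective n X) :
    complexGysin μ hX (IsSmoothProjective.tensor_holds hX hX) (lift (𝟙 X) (𝟙 X))
        (show 0 + 2 * (n + n) = 2 * n + 2 * n by omega)
        (singularCohomology.one ℂ (ComplexPoints X)) ∈ algebraicClasses (X ⊗ X) n :=
  complexGysin_mem_supportedClasses (gysinMap_restrictCompl_eq_zero_of_field ℂ) μ hμ hX
    (IsSmoothProjective.tensor_holds hX hX) (lift (𝟙 X) (𝟙 X)) _ (r := 0) (by omega)
    (by rw [supportedClasses_zero]; exact Submodule.mem_top)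

/-- **The diagonal acts as the identity correspondence** (Fulton §16.1: `[Δ]` is the unit of the
ring of correspondences and acts as the identity): `P_{Δ₊ 1} β = pr₁₊(pr₂^* β ∪ Δ₊ 1) = β` on
`Hᵃ(X(ℂ); ℂ)`. Proof: the projection formula for `Δ` read right to left,
`pr₂^* β ∪ Δ₊ 1 = Δ₊(Δ^* pr₂^* β ∪ 1)` (`complexGysin_cup`), `∪ 1 = id` (`cupProduct_one`),
`Δ^* pr₂^* = (Δ ≫ pr₂)^* = id` and `pr₁₊ Δ₊ = (Δ ≫ pr₁)₊ = (𝟙 X)₊ = id` (`complexGysin_comp`,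
`complexGysin_id`). [cite: Fulton1998, §16.1 Prop. 16.1.1 and Def. 16.1.2] -/
theorem corrAction_gysinDiagonal_one {μ : OrientationFamily} (hμ : μ.HasPoincareDuality)
    {n : ℕ} {X : SchemeOver ℂ} (hX : IsSmoothProjective n X) (a : ℕ) :
    corrAction μ hX hX (rfl : a + 2 * n = a + 2 * n)
        (complexGysin μ hX (IsSmoothProjective.tensor_holds hX hX) (lift (𝟙 X) (𝟙 X))
          (show 0 + 2 * (n + n) = 2 * n + 2 * n by omega)
          (singularCohomology.one ℂ (ComplexPoints X))) =
      LinearMap.id := by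
  have hXX := IsSmoothProjective.tensor_holds hX hX
  refine LinearMap.ext fun β => ?_
  rw [corrAction_apply, LinearMap.id_apply,
    ← complexGysin_cup hμ hX hXX (lift (𝟙 X) (𝟙 X)) (Nat.add_zero a)
      (show a + 2 * (n + n) = a + 2 * n + 2 * n by omega)
      (show 0 + 2 * (n + n) = 2 * n + 2 * n by omega) rfl
      (complexBetti.map (snd X X) a β) (singularCohomology.one ℂ (ComplexPoints X)),
    cupProduct_one, ← CategoryTheory.comp_apply, ← complexBetti.map_comp, lift_snd,
    complexBetti.map_id, CategoryTheory.id_apply,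
    ← LinearMap.comp_apply (f := complexGysin μ hXX hX (fst X X) _),
    ← complexGysin_comp hμ hX hXX hX (lift (𝟙 X) (𝟙 X)) (fst X X)]
  simp only [lift_fst]
  rw [complexGysin_id hμ hX a, LinearMap.id_apply]

/-- **The actions of algebraic self-correspondences are closed under composition** (Fulton
Prop. 16.1.1 (a) with Buskin's Lemma 6.3): for `μ` with Poincaré duality, `X` smooth projective
of dimension `n` and algebraic `γ, γ' ∈ Nⁿ H²ⁿ((X ⊗ X)(ℂ); ℂ)`, there is an algebraic `γ''` with
`P_{γ''} = P_γ ∘ P_{γ'}` on `Hᵃ(X(ℂ); ℂ)`, namely `γ'' = c • p₁₃₊(p₁₂^* γ ∪ p₂₃^* γ')`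
(`corr_comp_of_baseChange` with the Gysin base change `gysin_baseChange`, which supplies the
scalar `c`; algebraic by `corrCompClass_mem_algebraicClasses`), GRANTED the multiplicativity
`Nⁿ ∪ Nⁿ ⊆ N²ⁿ` of algebraic classes on `X ⊗ (X ⊗ X)` (`hCUP`, Voisin II Prop. 9.20).
[cite: Fulton1998, §16.1 Prop. 16.1.1 and Def. 16.1.2] [cite: Buskin2019, Lemma 6.3]
[cite: VoisinHodgeII2003, §9.2.4 Prop. 9.20] -/
theorem exists_algebraic_corrAction_comp {μ : OrientationFamily} (hμ : μ.HasPoincareDuality)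
    {n : ℕ} {X : SchemeOver ℂ} (hX : IsSmoothProjective n X)
    (hCUP : ∀ a ∈ algebraicClasses (X ⊗ (X ⊗ X)) n, ∀ b ∈ algebraicClasses (X ⊗ (X ⊗ X)) n,
      cupProduct ((Nat.mul_add 2 n n).symm : 2 * n + 2 * n = 2 * (n + n)) a b ∈
        algebraicClasses (X ⊗ (X ⊗ X)) (n + n))
    (a : ℕ) {γ : complexBetti (X ⊗ X) (2 * n)} (hγ : γ ∈ algebraicClasses (X ⊗ X) n)
    {γ' : complexBetti (X ⊗ X) (2 * n)} (hγ' : γ' ∈ algebraicClasses (X ⊗ X) n) :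
    ∃ γ'' ∈ algebraicClasses (X ⊗ X) n,
      corrAction μ hX hX (rfl : a + 2 * n = a + 2 * n) γ'' =
        corrAction μ hX hX (rfl : a + 2 * n = a + 2 * n) γ ∘ₗ
          corrAction μ hX hX (rfl : a + 2 * n = a + 2 * n) γ' := by
  obtain ⟨c, hc⟩ := gysin_baseChange μ hX hX hX (show a + 2 * n + 2 * n = a + 2 * (n + n) by omega)
  refine ⟨c • complexGysin μ
      (IsSmoothProjective.tensor_holds hX (IsSmoothProjective.tensor_holds hX hX))
      (IsSmoothProjective.tensor_holds hX hX) (X ◁ snd X X)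
      (show 2 * (n + n) + 2 * (n + n) = 2 * n + 2 * (n + (n + n)) by omega)
      (cupProduct ((Nat.mul_add 2 n n).symm : 2 * n + 2 * n = 2 * (n + n))
        (complexBetti.map (X ◁ fst X X) (2 * n) γ) (complexBetti.map (snd X (X ⊗ X)) (2 * n) γ')),
    Submodule.smul_mem _ c (corrCompClass_mem_algebraicClasses hμ hX hX hX (e := n) (e' := n)
      (e'' := n) rfl hCUP hγ hγ'), LinearMap.ext fun y => ?_⟩
  rw [LinearMap.comp_apply, corrAction_apply, corrAction_apply, corrAction_apply]
  exact corr_comp_of_baseChange hμ hX hX hX (e := n) (j := 2 * n) (k := 2 * n) (d := 2 * (n + n))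
    (a := a) (a₁ := a) (a₂ := a) rfl rfl rfl ((Nat.mul_add 2 n n).symm) γ γ' c hc y



/-- **LANDED p91059 as `stub_corrAlgebra` of line `IdeatorThreeSketch`
(`Theorems/EndoscopicMiddleDegreeOrthogonalEnvelopedCorrAlgebra.lean`; proof inlined verbatim until the farm serves
that module to crux workfiles) — the actions of algebraic self-correspondences form an algebra (KNOWN: Fulton
§16.1 Prop. 16.1.1 / Def. 16.1.2; provable now in the tree).** For `μ` with Poincaré duality and
`X` smooth projective of dimension `2(m+1)`, GRANTED the cup-multiplicativity of Stub 2 on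
`X ⊗ (X ⊗ X)`: (i) `P_δ = id` for some algebraic `δ` (the diagonal `Δ_* 1`, by the projection
formula `complexGysin_cup`, `complexGysin_comp`, `complexGysin_id`, algebraic since Gysin images
of algebraic classes are algebraic — `corrAction_gysinDiagonal_one`,
`gysinDiagonal_one_mem_algebraicClasses`); (ii) for algebraic `γ, γ'` there is an algebraic `γ''`
with `P_{γ''} = P_γ ∘ P_{γ'}` (`γ'' = c • p₁₃₊(p₁₂^* γ ∪ p₂₃^* γ')`: `corr_comp_of_baseChange`
with the proved `gysin_baseChange`, algebraic by `corrCompClass_mem_algebraicClasses` —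
`exists_algebraic_corrAction_comp`). [cite: Fulton1998, §16.1 Prop. 16.1.1 and Def. 16.1.2]
[cite: VoisinHodgeII2003, §9.2.4 Prop. 9.20] -/
theorem corrAlgebra_landed :
    ∀ (μ : OrientationFamily), μ.HasPoincareDuality →
      ∀ (m : ℕ) (X : SchemeOver ℂ) (hX : IsSmoothProjective (2 * (m + 1)) X),
        (∀ a ∈ algebraicClasses (X ⊗ (X ⊗ X)) (2 * (m + 1)),
          ∀ b ∈ algebraicClasses (X ⊗ (X ⊗ X)) (2 * (m + 1)),
            cupProduct ((Nat.mul_add 2 (2 * (m + 1)) (2 * (m + 1))).symm :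
                2 * (2 * (m + 1)) + 2 * (2 * (m + 1)) = 2 * (2 * (m + 1) + 2 * (m + 1))) a b ∈
              algebraicClasses (X ⊗ (X ⊗ X)) (2 * (m + 1) + 2 * (m + 1))) →
        (∃ δ ∈ algebraicClasses (X ⊗ X) (2 * (m + 1)),
            corrAction μ hX hX
                (rfl : 2 * (m + 1) + 2 * (2 * (m + 1)) = 2 * (m + 1) + 2 * (2 * (m + 1))) δ =
              LinearMap.id) ∧
        (∀ γ ∈ algebraicClasses (X ⊗ X) (2 * (m + 1)), ∀ γ' ∈ algebraicClasses (X ⊗ X) (2 * (m + 1)),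
            ∃ γ'' ∈ algebraicClasses (X ⊗ X) (2 * (m + 1)),
              corrAction μ hX hX
                  (rfl : 2 * (m + 1) + 2 * (2 * (m + 1)) = 2 * (m + 1) + 2 * (2 * (m + 1))) γ'' =
                corrAction μ hX hX
                    (rfl : 2 * (m + 1) + 2 * (2 * (m + 1)) = 2 * (m + 1) + 2 * (2 * (m + 1))) γ ∘ₗ
                  corrAction μ hX hX
                    (rfl : 2 * (m + 1) + 2 * (2 * (m + 1)) = 2 * (m + 1) + 2 * (2 * (m + 1))) γ') := by
  intro μ hμ m X hX hCUP
  exact ⟨⟨_, gysinDiagonal_one_mem_algebraicClasses μ hμ hX,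
      corrAction_gysinDiagonal_one hμ hX (2 * (m + 1))⟩,
    fun γ hγ γ' hγ' => exists_algebraic_corrAction_comp hμ hX hCUP (2 * (m + 1)) hγ hγ'⟩

/-! ## Helper lemmas (worker): atoms of a finite Boolean algebra of idempotents -/

/-- **Products of partial sums of orthogonal idempotents.** If the elements of the finite family `z`
of a ring are idempotent and pairwise orthogonal, then for `K, L ⊆ z`:
`(Σ_{a ∈ K} a) (Σ_{b ∈ L} b) = Σ_{a ∈ K ∩ L} a`. [folklore] -/
theorem rationalBlocks_sum_mul_sum_eq_sum_inter {E : Type*} [Ring E] [DecidableEq E]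
    {z K L : Finset E} (hzi : ∀ a ∈ z, a * a = a) (hzo : ∀ a ∈ z, ∀ b ∈ z, a ≠ b → a * b = 0)
    (hK : K ⊆ z) (hL : L ⊆ z) :
    (∑ a ∈ K, a) * (∑ b ∈ L, b) = ∑ a ∈ K ∩ L, a := by
  rw [Finset.sum_mul_sum, ← Finset.sum_ite_mem]
  refine Finset.sum_congr rfl fun a ha => ?_
  calc ∑ b ∈ L, a * b = ∑ b ∈ L, (if a = b then a else 0) :=
        Finset.sum_congr rfl fun b hb => by
          split_ifs with h
          · subst h
            exact hzi a (hK ha)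
          · exact hzo a (hK ha) b (hL hb) h
    _ = if a ∈ L then a else 0 := Finset.sum_ite_eq L a fun _ => a

/-- **Atoms of a finite Boolean algebra of idempotents.** Let `P` be a property of elements of a
ring `E` stable under `1`, products and differences, and `z ⊆ E` a finite family of non-zero,
pairwise orthogonal idempotents with `Σ_{a ∈ z} a = 1`, *primitive towards `P`-idempotents*:
`f a ∈ {0, a}` for every idempotent `f` with `P f` and every `a ∈ z`. Then there is a finite family
`s` of pairwise orthogonal `P`-idempotents with `Σ_{e ∈ s} e = 1`, each primitive towards
`P`-idempotents (`f e ∈ {0, e}`). Construction: every `P`-idempotent is `z_K := Σ_{a ∈ K} a` for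
`K = {a ∈ z | f a = a}`; the subsets `K ⊆ z` with `P z_K` ("good") are stable under `∩`
(`z_K z_L = z_{K ∩ L}`) and differences (`z_{K ∖ L} = z_K - z_L`), and `z` is good (`z_z = 1`); the
blocks are the `z_A` over the ATOMS `A` (minimal non-empty good subsets), which are pairwise disjoint
and cover `z` (a good subset containing `a` of minimal cardinality is an atom); primitivity:
`z_K z_A = z_{K ∩ A}` and `K ∩ A ∈ {∅, A}` by minimality. [folklore] -/
theorem rationalBlocks_exists_finset_atoms {E : Type*} [Ring E] (P : E → Prop) (h1 : P 1)
    (hmul : ∀ a b, P a → P b → P (a * b)) (hsub : ∀ a b, P a → P b → P (a - b))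
    (z : Finset E) (hz0 : ∀ a ∈ z, a ≠ 0) (hzi : ∀ a ∈ z, a * a = a)
    (hzo : ∀ a ∈ z, ∀ b ∈ z, a ≠ b → a * b = 0) (hz1 : ∑ a ∈ z, a = 1)
    (hzp : ∀ f, P f → f * f = f → ∀ a ∈ z, f * a = 0 ∨ f * a = a) :
    ∃ s : Finset E,
      (∀ e ∈ s, P e ∧ e * e = e ∧ ∀ f, P f → f * f = f → f * e = 0 ∨ f * e = e) ∧
      (∀ e ∈ s, ∀ e' ∈ s, e ≠ e' → e * e' = 0) ∧ ∑ e ∈ s, e = 1 := by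
  classical
  -- `z_K z_L = z_{K ∩ L}` and `z_{K \ L} = z_K - z_L`
  have hmulσ : ∀ K L : Finset E, K ⊆ z → L ⊆ z →
      (∑ a ∈ K, a) * (∑ a ∈ L, a) = ∑ a ∈ K ∩ L, a :=
    fun K L hK hL => rationalBlocks_sum_mul_sum_eq_sum_inter hzi hzo hK hL
  have hsubσ : ∀ K L : Finset E, L ⊆ K → ∑ a ∈ K \ L, a = (∑ a ∈ K, a) - ∑ a ∈ L, a :=
    fun K L h => eq_sub_of_add_eq (Finset.sum_sdiff h)
  -- good subsets (`z_K` has `P`) and atoms (minimal non-empty good subsets)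
  let good : Finset E → Prop := fun K => K ⊆ z ∧ P (∑ a ∈ K, a)
  let atom : Finset E → Prop := fun A =>
    good A ∧ A.Nonempty ∧ ∀ K, good K → K ⊆ A → K.Nonempty → K = A
  have good_inter : ∀ K L : Finset E, good K → good L → good (K ∩ L) := fun K L hK hL =>
    ⟨Finset.inter_subset_left.trans hK.1, by
      rw [← hmulσ K L hK.1 hL.1]
      exact hmul _ _ hK.2 hL.2⟩
  have good_sdiff : ∀ K L : Finset E, good K → good L → L ⊆ K → good (K \ L) :=
    fun K L hK hL h =>
      ⟨Finset.sdiff_subset.trans hK.1, by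
        rw [hsubσ K L h]
        exact hsub _ _ hK.2 hL.2⟩
  have good_z : good z := ⟨Finset.Subset.refl _, by rw [hz1]; exact h1⟩
  -- two distinct atoms are disjoint
  have atom_disj : ∀ A A' : Finset E, atom A → atom A' → A ≠ A' → A ∩ A' = ∅ := by
    intro A A' hA hA' hne
    by_contra h
    have hn : (A ∩ A').Nonempty := Finset.nonempty_iff_ne_empty.mpr h
    have hg := good_inter A A' hA.1 hA'.1
    exact hne ((hA.2.2 _ hg Finset.inter_subset_left hn).symm.trans
      (hA'.2.2 _ hg Finset.inter_subset_right hn))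
  -- every `P`-idempotent is `z_K` for a good `K`
  have repr : ∀ f, P f → f * f = f → ∃ K : Finset E, good K ∧ ∑ a ∈ K, a = f := by
    intro f hf hff
    have key : f = ∑ a ∈ z.filter (fun a => f * a = a), a := by
      rw [Finset.sum_filter]
      calc f = f * ∑ a ∈ z, a := by rw [hz1, mul_one]
        _ = ∑ a ∈ z, f * a := Finset.mul_sum _ _ _
        _ = ∑ a ∈ z, if f * a = a then a else 0 := Finset.sum_congr rfl fun a ha => by
          rcases hzp f hf hff a ha with h | h
          · rw [h]
            split_ifs with h'
            · exact h'
            · rfl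
          · rw [h, if_pos rfl]
    exact ⟨_, ⟨Finset.filter_subset _ _, by rw [← key]; exact hf⟩, key.symm⟩
  -- every element of `z` lies in an atom: a good subset containing it of minimal cardinality
  have cover : ∀ a ∈ z, ∃ A : Finset E, atom A ∧ a ∈ A := by
    intro a ha
    obtain ⟨A, hA, hmin⟩ := Finset.exists_min_image
      (z.powerset.filter fun K => good K ∧ a ∈ K) Finset.card
      ⟨z, Finset.mem_filter.mpr ⟨Finset.mem_powerset.mpr (Finset.Subset.refl _), good_z, ha⟩⟩
    obtain ⟨-, hAg, haA⟩ := Finset.mem_filter.mp hA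
    have hmin' : ∀ K, good K → a ∈ K → ¬ K ⊂ A := fun K hK haK hlt =>
      not_le.mpr (Finset.card_lt_card hlt)
        (hmin K (Finset.mem_filter.mpr ⟨Finset.mem_powerset.mpr hK.1, hK, haK⟩))
    refine ⟨A, ⟨hAg, ⟨a, haA⟩, fun K hK hKA hKn => ?_⟩, haA⟩
    by_contra hne
    by_cases haK : a ∈ K
    · exact hmin' K hK haK (Finset.ssubset_iff_subset_ne.mpr ⟨hKA, hne⟩)
    · exact hmin' (A \ K) (good_sdiff A K hAg hK hKA) (Finset.mem_sdiff.mpr ⟨haA, haK⟩)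
        (Finset.sdiff_ssubset hKA hKn)
  -- the blocks: `z_A` over the atoms `A`
  set 𝒜 : Finset (Finset E) := z.powerset.filter atom
  have mem𝒜 : ∀ A, A ∈ 𝒜 ↔ atom A := fun A =>
    ⟨fun h => (Finset.mem_filter.mp h).2,
      fun h => Finset.mem_filter.mpr ⟨Finset.mem_powerset.mpr h.1.1, h⟩⟩
  refine ⟨𝒜.image fun A => ∑ a ∈ A, a, ?_, ?_, ?_⟩
  · -- `P`, idempotent, primitive towards `P`-idempotents
    intro e he
    obtain ⟨A, hA, rfl⟩ := Finset.mem_image.mp he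
    rw [mem𝒜] at hA
    refine ⟨hA.1.2, by rw [hmulσ A A hA.1.1 hA.1.1, Finset.inter_self], fun f hf hff => ?_⟩
    obtain ⟨K, hK, rfl⟩ := repr f hf hff
    rw [hmulσ K A hK.1 hA.1.1]
    by_cases hKA : (K ∩ A).Nonempty
    · exact Or.inr (by rw [hA.2.2 _ (good_inter K A hK hA.1) Finset.inter_subset_right hKA])
    · exact Or.inl (by rw [Finset.not_nonempty_iff_eq_empty.mp hKA, Finset.sum_empty])
  · -- pairwise orthogonal
    intro e he e' he' hne
    obtain ⟨A, hA, rfl⟩ := Finset.mem_image.mp he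
    obtain ⟨A', hA', rfl⟩ := Finset.mem_image.mp he'
    rw [mem𝒜] at hA hA'
    rw [hmulσ A A' hA.1.1 hA'.1.1, atom_disj A A' hA hA' (fun h => hne (by rw [h])),
      Finset.sum_empty]
  · -- `Σ_A z_A = z_{⋃ A} = z_z = 1`
    have hdisj : (↑𝒜 : Set (Finset E)).PairwiseDisjoint id := fun A hA A' hA' hne =>
      Finset.disjoint_iff_inter_eq_empty.mpr
        (atom_disj A A' ((mem𝒜 A).mp hA) ((mem𝒜 A').mp hA') hne)
    have hinj : Set.InjOn (fun A : Finset E => ∑ a ∈ A, a) ↑𝒜 := by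
      intro A hA A' hA' hAA'
      have hAA' : ∑ a ∈ A, a = ∑ a ∈ A', a := hAA'
      by_contra hne
      have hA := (mem𝒜 A).mp hA
      have hA' := (mem𝒜 A').mp hA'
      obtain ⟨a, haA⟩ := hA.2.1
      have h0 : ∑ x ∈ A, x = 0 := by
        calc ∑ x ∈ A, x = (∑ x ∈ A, x) * ∑ x ∈ A', x := by
              rw [← hAA', hmulσ A A hA.1.1 hA.1.1, Finset.inter_self]
          _ = 0 := by
              rw [hmulσ A A' hA.1.1 hA'.1.1, atom_disj A A' hA hA' hne, Finset.sum_empty]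
      have ha0 : a = 0 := by
        calc a = ∑ x ∈ A ∩ {a}, x := by
              rw [Finset.inter_singleton_of_mem haA, Finset.sum_singleton]
          _ = (∑ x ∈ A, x) * ∑ x ∈ ({a} : Finset E), x :=
              (hmulσ A {a} hA.1.1 (Finset.singleton_subset_iff.mpr (hA.1.1 haA))).symm
          _ = 0 := by rw [h0, zero_mul]
      exact hz0 a (hA.1.1 haA) ha0
    have hcov : 𝒜.biUnion id = z := by
      refine Finset.Subset.antisymm
        (Finset.biUnion_subset.mpr fun A hA => ((mem𝒜 A).mp hA).1.1) fun a ha => ?_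
      obtain ⟨A, hA, haA⟩ := cover a ha
      exact Finset.mem_biUnion.mpr ⟨A, (mem𝒜 A).mpr hA, haA⟩
    rw [Finset.sum_image hinj]
    calc ∑ A ∈ 𝒜, ∑ a ∈ A, a = ∑ a ∈ 𝒜.biUnion id, a := (Finset.sum_biUnion hdisj).symm
      _ = 1 := by rw [hcov, hz1]



/-- **LANDED p87916 as `stub_rationalBlocks` of line `IdeatorThreeSketch`
(`Theorems/EndoscopicMiddleDegreeOrthogonalEnvelopedRationalBlocks.lean`; proof inlined verbatim until the farm serves
that module) — the ℚ-block decomposition of the Hecke algebra (KNOWN: the `ℚ`-Hecke-isotypic pieces,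
BMM Part 2 §1.9 / Thm 61; finite-dimensional linear algebra in Lean).** For `m ∈ {1,2}` and a datum
`D`, let `𝓗 = Algebra.adjoin ℂ (range (D.heckeCorrespondenceAction (2n)))` on `H = H²ⁿ(X(ℂ); ℂ)`,
`n = m + 1`. There is a finite family `s` of pairwise orthogonal endomorphisms summing to `1`, each of
which lies in `𝓗`, is idempotent, central in `𝓗`, preserves rational classes, and is PRIMITIVE among
the rational-preserving central idempotents `f` of `𝓗` (`f ε ∈ {0, ε}`). Proof: `H` is
finite-dimensional (`finite_complexBetti D.isSmoothProjective`), so `𝓗` has `ℂ`-block idempotents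
(`exists_primitiveCentralIdempotents`: non-zero, pairwise orthogonal central idempotents summing to
`1`, primitive among central idempotents); the `ℚ`-blocks are the sums of `ℂ`-blocks over the atoms of
the finite Boolean algebra of those subsets whose sum preserves rational classes
(`rationalBlocks_exists_finset_atoms` with `P` = "central in `𝓗` and rational-preserving", stable
under `1`, products and differences by `IsRationalClass.add/.smul`).
[cite: BergeronMillsonMoeglin2016Balls, Part 2 §1.9 and Thm. 61] -/
theorem rationalBlocks_landed :
    ∀ (m : ℕ) (X : SchemeOver ℂ) (D : UnitaryBallQuotientDatum (2 * (m + 1)) X), 1 ≤ m → m ≤ 2 →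
      ∃ s : Finset (Module.End ℂ (complexBetti X (2 * (m + 1)))),
        (∀ ε ∈ s,
          ε ∈ Algebra.adjoin ℂ (Set.range (D.heckeCorrespondenceAction (2 * (m + 1)))) ∧
          ε * ε = ε ∧
          (∀ T ∈ Algebra.adjoin ℂ (Set.range (D.heckeCorrespondenceAction (2 * (m + 1)))),
            T * ε = ε * T) ∧
          (∀ β, IsRationalClass β → IsRationalClass (ε β)) ∧
          (∀ f ∈ Algebra.adjoin ℂ (Set.range (D.heckeCorrespondenceAction (2 * (m + 1)))),
            f * f = f →
            (∀ T ∈ Algebra.adjoin ℂ (Set.range (D.heckeCorrespondenceAction (2 * (m + 1)))),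
              T * f = f * T) →
            (∀ β, IsRationalClass β → IsRationalClass (f β)) → f * ε = 0 ∨ f * ε = ε)) ∧
        (∀ ε ∈ s, ∀ ε' ∈ s, ε ≠ ε' → ε * ε' = 0) ∧
        ∑ ε ∈ s, ε = 1 := by
  intro m X D _ _
  haveI := finite_complexBetti D.isSmoothProjective (2 * (m + 1))
  set 𝓗 := Algebra.adjoin ℂ (Set.range (D.heckeCorrespondenceAction (2 * (m + 1))))
  -- the `ℂ`-blocks: primitive central idempotents of `𝓗`
  obtain ⟨z, hz, hz1⟩ := exists_primitiveCentralIdempotents 𝓗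
  -- rational classes are stable under differences
  have rat_sub : ∀ x y : complexBetti X (2 * (m + 1)), IsRationalClass x → IsRationalClass y →
      IsRationalClass (x - y) := fun x y hx hy => by
    have h := hx.add (hy.smul (-1))
    rwa [Rat.cast_neg, Rat.cast_one, neg_one_smul, ← sub_eq_add_neg] at h
  -- the atoms of the Boolean algebra of rational-preserving central idempotents
  obtain ⟨s, hs, ho, hsum⟩ := rationalBlocks_exists_finset_atoms
    (fun T : Module.End ℂ (complexBetti X (2 * (m + 1))) =>
      T ∈ 𝓗 ∧ (∀ S ∈ 𝓗, S * T = T * S) ∧ ∀ β, IsRationalClass β → IsRationalClass (T β))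
    ⟨𝓗.one_mem, fun S _ => by rw [mul_one, one_mul], fun β hβ => by
      rwa [Module.End.one_apply]⟩
    (fun a b ha hb => ⟨𝓗.mul_mem ha.1 hb.1,
      fun S hS => by rw [← mul_assoc, ha.2.1 S hS, mul_assoc, hb.2.1 S hS, mul_assoc],
      fun β hβ => by
        rw [Module.End.mul_apply]
        exact ha.2.2 _ (hb.2.2 β hβ)⟩)
    (fun a b ha hb => ⟨𝓗.sub_mem ha.1 hb.1,
      fun S hS => by rw [mul_sub, sub_mul, ha.2.1 S hS, hb.2.1 S hS],
      fun β hβ => by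
        rw [LinearMap.sub_apply]
        exact rat_sub _ _ (ha.2.2 β hβ) (hb.2.2 β hβ)⟩)
    z (fun a ha => (hz a ha).2.1) (fun a ha => (hz a ha).1.2.1)
    (fun a ha b hb hab => by
      -- distinct primitive central idempotents are orthogonal
      have hcomm : b * a = a * b := (hz a ha).1.2.2 b (hz b hb).1.1
      rcases (hz b hb).2.2 a (hz a ha).1 with h | h
      · exact h
      · rcases (hz a ha).2.2 b (hz b hb).1 with h' | h'
        · rw [← hcomm]
          exact h'
        · exact absurd (h'.symm.trans (hcomm.trans h)) hab)
    hz1 (fun f hf hff a ha => (hz a ha).2.2 f ⟨hf.1, hff, hf.2.1⟩)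
  refine ⟨s, fun ε hε => ?_, ho, hsum⟩
  obtain ⟨⟨h1, h2, h3⟩, h4, h5⟩ := hs ε hε
  exact ⟨h1, h4, h2, h3, fun f hf hff hfc hfr => h5 f ⟨hf, hfc, hfr⟩ hff⟩

/-! ## The registered stubs -/

/-- **Stub 1 (shared with line `IdeatorThreeSketch`, byte-identical) — the Hecke correspondences are
algebraic, in push–pull form (KNOWN in print, a CONSTRUCTION missing in the tree: Shimura 1971 §7.3;
BMM arXiv:1306.1515 Part 2 §1.8 / Thm 61; XL).** For `μ` with Poincaré duality, `m ∈ {1,2}`, a datum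
`D` and an ADMISSIBLE `g ∉ Γ`, the Hecke operator `T_g = [Γ' : N_g]⁻¹ · τ ∘ π_g^*` on
`H^{2(m+1)}(X(ℂ); ℂ)` equals `c • π₊ π'^*` for a smooth projective `S` of dimension `2(m+1)` (on paper:
the level cover `S(Γ ∩ g⁻¹Γg)`, algebraic by Baily–Borel + GAGA, finite étale over `X`), scheme
morphisms `π π' : S ⟶ X`, `π₊ = complexGysin μ` and a scalar `c`.
[cite: arXiv:1306.1515, Part 2 §1.8 and Thm 61] -/
theorem stub_heckePushPull :
    ∀ (μ : OrientationFamily), μ.HasPoincareDuality →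
      ∀ (m : ℕ) (X : SchemeOver ℂ) (D : UnitaryBallQuotientDatum (2 * (m + 1)) X), 1 ≤ m → m ≤ 2 →
        ∀ g : GL (Fin (2 * (m + 1) + 1)) D.E, D.IsHeckeAdmissible g → g ∉ D.Γ →
          ∃ (S : SchemeOver ℂ) (hS : IsSmoothProjective (2 * (m + 1)) S) (π π' : S ⟶ X) (c : ℂ),
            D.heckeCorrespondenceAction (2 * (m + 1)) g =
              c • (complexGysin μ hS D.isSmoothProjective π
                  (rfl : 2 * (m + 1) + 2 * (2 * (m + 1)) = 2 * (m + 1) + 2 * (2 * (m + 1))) ∘ₗ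
                (complexBetti.map π' (2 * (m + 1))).hom) := by
  sorry

/-- **Stub 2 (shared, byte-identical) — cup products of algebraic classes on the triple product are
algebraic (KNOWN: Voisin II Prop. 9.20; Fulton §19.2 with the moving lemma §11.4): the instance on
`X ⊗ (X ⊗ X)`, `l = k = 2(m+1)`, of the route's support item `CupProductAlgebraic`
(stmt-HodgeConjecture-14350) — verbatim the hypothesis of `corrAlgebra_landed` (= landed `stub_corrAlgebra`).**
[cite: VoisinHodgeII2003, Prop. 9.20] -/
theorem stub_cupTriple :
    ∀ (m : ℕ) (X : SchemeOver ℂ), IsSmoothProjective (2 * (m + 1)) X →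
      ∀ a ∈ algebraicClasses (X ⊗ (X ⊗ X)) (2 * (m + 1)),
        ∀ b ∈ algebraicClasses (X ⊗ (X ⊗ X)) (2 * (m + 1)),
          cupProduct ((Nat.mul_add 2 (2 * (m + 1)) (2 * (m + 1))).symm :
              2 * (2 * (m + 1)) + 2 * (2 * (m + 1)) = 2 * (2 * (m + 1) + 2 * (m + 1))) a b ∈
            algebraicClasses (X ⊗ (X ⊗ X)) (2 * (m + 1) + 2 * (m + 1)) := by
  sorry


/-- **Stub 3 (NEW, lead reshape R1) — EXACT ARCHIMEDEAN DATA FROM HODGE-TYPE STABILITY (provable now,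
pure Hodge-decomposition bookkeeping; M).** For `X` smooth projective of dimension `2(m+1)` and ANY
endomorphism `z` of `H = H^{2(m+1)}(X(ℂ); ℂ)` preserving every Hodge type `(p, q)`, there are block data
`(b, S)` satisfying the written-out ArchData conjunction of the planner's `stub_archDictionary`: take
`r := 2(m+1)+1`, `b ≡ 1` (all blocks singletons, so `ajTypes b i = {(i, 2(m+1) - i)}`), and
`S := {i | some non-zero class of type (i, 2(m+1) - i) lies in range z}`; clause (3) holds because every
`c = z c' ∈ range z` is `Σ_{p+q=2(m+1)} z c'_{pq}` (Hodge decomposition of `c'` in one Hodge model,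
`HodgeModel.exists_sum_eq_of_hodgeDecomposition` + `hodgePQ_independent_of_hodgeModel_holds.isOfHodgeType_iff`),
each `z c'_{pq}` being of type `(p,q)` and in `range z`, hence zero or witnessing `p ∈ S`; clause (4)
is the definition of `S`. This shows that the dictionary's typed conjunction does not pin Arthur's
archimedean data (finding R1). [cite: VoisinHodgeI2002, §6.1.3 and §7.1.1] -/
theorem stub_archDataOfHodgeStable :
    ∀ (m : ℕ) (X : SchemeOver ℂ), IsSmoothProjective (2 * (m + 1)) X →
      ∀ z : Module.End ℂ (complexBetti X (2 * (m + 1))),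
        (∀ (p q : ℕ) (c : complexBetti X (2 * (m + 1))),
          IsOfHodgeType (2 * (m + 1)) X (2 * (m + 1)) p q c →
            IsOfHodgeType (2 * (m + 1)) X (2 * (m + 1)) p q (z c)) →
        ∃ (r : ℕ) (b : Fin r → ℕ) (S : Finset (Fin r)),
          ((∑ k, b k = 2 * (m + 1) + 1) ∧ (∀ i ∈ S, ∀ j ∈ S, b i = b j) ∧
          LinearMap.range z ≤ Submodule.span ℂ {c : complexBetti X (2 * (m + 1)) |
            ∃ pq ∈ ajTypesOf b S (2 * (m + 1)), IsOfHodgeType (2 * (m + 1)) X (2 * (m + 1)) pq.1 pq.2 c} ∧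
          ∀ pq ∈ ajTypesOf b S (2 * (m + 1)), ∃ c ∈ LinearMap.range z, c ≠ 0 ∧
            IsOfHodgeType (2 * (m + 1)) X (2 * (m + 1)) pq.1 pq.2 c) := by
  sorry

/-- **Stub 4a (NEW, lead reshape R2) — ℂ-LINEAR RELATIONS AMONG RATIONAL CLASSES ARE SPANNED BY
ℚ-RELATIONS (provable now; M).** For rational classes `v₁, …, v_N ∈ Hᵏ(X(ℂ); ℂ)` and complex
coefficients `c` with `Σ cᵢ vᵢ = 0`, the vector `c ∈ ℂ^N` is a ℂ-combination of RATIONAL relation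
vectors `q ∈ ℚ^N`, `Σ qᵢ vᵢ = 0`. Proof on paper: `vᵢ = ι xᵢ` with `xᵢ ∈ Hᵏ(X(ℂ); ℚ)`
(`isRationalClass_iff_exists_ringChange`); choose a maximal ℚ-independent subfamily `(x_i)_{i ∈ I₀}`
(`exists_linearIndependent`), which stays ℂ-independent after `ι` (`linearIndependent_ringChange_iff`);
writing the other `x_j` as ℚ-combinations `Σ_{i ∈ I₀} a_{ji} x_i` gives, for each `j ∉ I₀`, the rational
relation `q^{(j)} = e_j - Σ_i a_{ji} e_i`, and `c = Σ_{j ∉ I₀} c_j q^{(j)}` by ℂ-independence of the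
`(v_i)_{i ∈ I₀}`. (Equivalently: `ker (Φ ⊗ ℂ) = (ker Φ) ⊗ ℂ` for the ℚ-linear `Φ q = Σ qᵢ xᵢ`, since
`Hᵏ(ℚ) ⊗ ℂ → Hᵏ(ℂ)` is injective.) [cite: VoisinHodgeI2002, §7.1.1] [cite: HatcherAT2002, §3.1 p. 198] -/
theorem stub_rationalRelations :
    ∀ (X : SchemeOver ℂ) (k N : ℕ) (v : Fin N → complexBetti X k), (∀ i, IsRationalClass (v i)) →
      ∀ c : Fin N → ℂ, ∑ i, c i • v i = 0 →
        c ∈ Submodule.span ℂ {c' : Fin N → ℂ |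
          (∃ q : Fin N → ℚ, c' = fun i ↦ (q i : ℂ)) ∧ ∑ i, c' i • v i = 0} := by
  sorry

/-- **Stub 4b (NEW, lead reshape R2) — INTERSECTIONS OF ℚ-SPANNED SUBSPACES OF `ℂ^N` ARE ℚ-SPANNED
(Mathlib-only linear algebra; provable now; S–M).** A subspace `W ≤ ℂ^N` is ℚ-spanned if it is
contained in (hence equal to) the ℂ-span of its rational points `W ∩ ℚ^N`. If `W₁`, `W₂` are ℚ-spanned,
so is `W₁ ⊓ W₂`. Proof on paper: for `S ⊆ ℚ^N`, `dim_ℂ span_ℂ S = dim_ℚ span_ℚ S` (a ℚ-independent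
family of rational vectors is ℂ-independent: the `ℚ`-matrix of a maximal minor has non-zero
determinant); hence `dim_ℂ (W₁ ⊓ W₂) = dim W₁ + dim W₂ - dim (W₁ + W₂)
= dim_ℚ W₁,ℚ + dim_ℚ W₂,ℚ - dim_ℚ (W₁,ℚ + W₂,ℚ) = dim_ℚ (W₁,ℚ ∩ W₂,ℚ) = dim_ℂ span_ℂ (W₁,ℚ ∩ W₂,ℚ)`, and
`span_ℂ (W₁,ℚ ∩ W₂,ℚ) ≤ W₁ ⊓ W₂`. (Equivalently: the kernel of a ℚ-matrix over `ℂ` is spanned by its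
kernel over `ℚ`.) [folklore] -/
theorem stub_ratSpannedInf :
    ∀ (N : ℕ) (W₁ W₂ : Submodule ℂ (Fin N → ℂ)),
      W₁ ≤ Submodule.span ℂ {c : Fin N → ℂ | c ∈ W₁ ∧ ∃ q : Fin N → ℚ, c = fun i ↦ (q i : ℂ)} →
      W₂ ≤ Submodule.span ℂ {c : Fin N → ℂ | c ∈ W₂ ∧ ∃ q : Fin N → ℚ, c = fun i ↦ (q i : ℂ)} →
        W₁ ⊓ W₂ ≤ Submodule.span ℂ {c : Fin N → ℂ | c ∈ W₁ ⊓ W₂ ∧ ∃ q : Fin N → ℚ, c = fun i ↦ (q i : ℂ)} := by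
  sorry

/-- **Stub 4c (NEW, lead reshape R2) — A RATIONAL FITTING IDEMPOTENT (provable now; L).** For `X`
smooth projective (so `Hᵏ(X(ℂ); ℂ)` is finite-dimensional and spanned by its rational classes,
`finite_complexBetti`, `span_isRationalClass_eq_top_of_isSmoothProjective_holds`) and an endomorphism
`j` of `Hᵏ(X(ℂ); ℂ)` preserving rational classes which is NOT nilpotent, some ℚ-polynomial multiple
`f = p(j) ∘ j` of `j` (`p ∈ ℚ[X]`) is a NON-ZERO IDEMPOTENT. Proof on paper: `j` restricts to the
finite-dimensional ℚ-space `Hᵏ(X(ℂ); ℚ)` (`j ∘ ι = ι ∘ j_ℚ`, `ι = ringChange` injective); factor its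
minimal polynomial over ℚ as `X^a · g` with `g(0) ≠ 0`
(`Polynomial.exists_eq_pow_rootMultiplicity_mul_and_not_dvd`); `X^a` and `g` are coprime
(`Polynomial.irreducible_X.coprime_iff_not_dvd`, `IsCoprime.pow_left`), `u X^a + v g = 1`; then
`f := (u X^a)(j)` (`a ≥ 1`; if `a = 0`, `j_ℚ` is invertible and `1 = w(j) j`, take `f = 1 = (w j) j`) is
idempotent (`(uX^a)(uX^a - 1) = -u v X^a g ≡ 0 mod minpoly`) and non-zero (else `g ∣ u X^a`, so `g ∣ u`,
so `g ∣ 1`, so the minimal polynomial is `X^a` and `j` is nilpotent); the identities transfer from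
`Hᵏ(ℚ)` to its ℂ-span `Hᵏ(ℂ)`. (This is the CRT/Fitting idempotent of the Artinian ℚ-algebra `ℚ[j]`
projecting onto the part where `j` is invertible.) [cite: VoisinHodgeI2002, §7.1.1] -/
theorem stub_rationalFitting :
    ∀ (n : ℕ) (X : SchemeOver ℂ), IsSmoothProjective n X → ∀ (k : ℕ)
      (j : Module.End ℂ (complexBetti X k)), (∀ β, IsRationalClass β → IsRationalClass (j β)) →
        ¬ IsNilpotent j →
          ∃ p : Polynomial ℚ,
            IsIdempotentElem (Polynomial.aeval j ((Polynomial.X * p).map (algebraMap ℚ ℂ))) ∧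
            Polynomial.aeval j ((Polynomial.X * p).map (algebraMap ℚ ℂ)) ≠ 0 := by
  sorry

/-- **Stub 5 (renamed `stub_coreVanishingArch`, signature UNCHANGED from the planner's `stub_coreVanishing`; after reshape R1 its
archimedean-data hypothesis is instantiated by every impure ℂ-block meeting `H^{n,n}`, see the header) — CORE VANISHING ON TEMPERED-TYPE CORES (THE BET = the route's CoreVanishing = Disproof F5
NoImpureRationalComponents, restricted by the card to its tempered core; HC-strength).** For `m ∈ {1,2}`,
a datum `D`, a ℚ-block `ε` of `𝓗` and a ℂ-block `z ≤ ε` carrying exact archimedean data `(b, S)` of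
TEMPERED-CORE SHAPE — `|S| ≥ 2`, all blocks of `S` singletons, one of them centred (the constituent
owning the middle `τ₁`-slot is cuspidal `Ψ_d ⊠ R₁`, `d = |S| ≥ 2`; the closed list of Disproof F5b:
`Ψ₅, Ψ₄∋0 ⊞ χ, Ψ₃∋0 ⊞ …, Ψ₂∋0 ⊞ …` at `N = 5`, `Ψ_d ∋ 0 ⊞ ψ'` (`ψ'` arbitrary, e.g. `Ψ₃ ⊞ ρ⊠R₂`) at
`N = 7`; `z(H)` then carries exactly the `d` types `(n - w, n + w)`, `w` the `τ₁`-weights of `Ψ_d`):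
`ε` kills every RATIONAL `(n,n)`-class `e` cup-orthogonal to the theta world `TW(D)` (the crux's
hypothesis, verbatim). PAPER STATUS: implied by HC on the sector (Disproof F1) + "Hodge ⟹ Tate" for
these pieces (the `ℓ`-adic realisation of the ℚ-piece `ε H` is `r(Ψ_d)`-isotypic through each
conjugate, irreducible of dimension `d ≥ 2` with `d` distinct Hodge–Tate weights for a density-one set
of `ℓ` — Calegari–Gee `d ≤ 5`, Patrikis–Taylor — so it has no Tate line); by nothing less in print.
The sieve half is free: if some conjugate ℂ-block of `ε` is killed, Stub 4 applies; by the dimension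
clause of the landed `stub_sieve` the conjugates of a core are cores of the same `d`. Why it might fail:
one rational `(2,2)`-class in one core piece of a compact `U(4,1)` quotient (likeliest the even core
`Ψ₄ ∋ 0 ⊞ χ`, `χ` off-centre at every embedding) — a failure of Hodge ⟹ Tate-type for these motives,
`¬HC`-adjacent (Disproof F1/F5). [cite: arXiv:1306.1515, Thm 61 and §5]
[cite: arXiv:1104.4827, Thm 1.2] [cite: arXiv:1307.1640, Thm A] [cite: arXiv:1804.05047, Thm 1.2] -/
theorem stub_coreVanishingArch :
    ∀ (m : ℕ) (X : SchemeOver ℂ) (D : UnitaryBallQuotientDatum (2 * (m + 1)) X), 1 ≤ m → m ≤ 2 →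
      ∀ ε : Module.End ℂ (complexBetti X (2 * (m + 1))),
        ε ∈ Algebra.adjoin ℂ (Set.range (D.heckeCorrespondenceAction (2 * (m + 1)))) →
        ε * ε = ε →
        (∀ T ∈ Algebra.adjoin ℂ (Set.range (D.heckeCorrespondenceAction (2 * (m + 1)))), T * ε = ε * T) →
        (∀ β, IsRationalClass β → IsRationalClass (ε β)) →
        (∀ f ∈ Algebra.adjoin ℂ (Set.range (D.heckeCorrespondenceAction (2 * (m + 1)))), f * f = f →
          (∀ T ∈ Algebra.adjoin ℂ (Set.range (D.heckeCorrespondenceAction (2 * (m + 1)))), T * f = f * T) →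
          (∀ β, IsRationalClass β → IsRationalClass (f β)) → f * ε = 0 ∨ f * ε = ε) →
        ∀ z : Module.End ℂ (complexBetti X (2 * (m + 1))),
          z ∈ Algebra.adjoin ℂ (Set.range (D.heckeCorrespondenceAction (2 * (m + 1)))) →
          z * z = z →
          (∀ T ∈ Algebra.adjoin ℂ (Set.range (D.heckeCorrespondenceAction (2 * (m + 1)))), T * z = z * T) →
          z ≠ 0 →
          (∀ f ∈ Algebra.adjoin ℂ (Set.range (D.heckeCorrespondenceAction (2 * (m + 1)))), f * f = f →
            (∀ T ∈ Algebra.adjoin ℂ (Set.range (D.heckeCorrespondenceAction (2 * (m + 1)))), T * f = f * T) →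
            f * z = 0 ∨ f * z = z) →
          z * ε = z →
          (∃ (r : ℕ) (b : Fin r → ℕ) (S : Finset (Fin r)),
            ((∑ k, b k = 2 * (m + 1) + 1) ∧ (∀ i ∈ S, ∀ j ∈ S, b i = b j) ∧
              LinearMap.range z ≤ Submodule.span ℂ {c : complexBetti X (2 * (m + 1)) |
                ∃ pq ∈ ajTypesOf b S (2 * (m + 1)), IsOfHodgeType (2 * (m + 1)) X (2 * (m + 1)) pq.1 pq.2 c} ∧
              ∀ pq ∈ ajTypesOf b S (2 * (m + 1)), ∃ c ∈ LinearMap.range z, c ≠ 0 ∧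
                IsOfHodgeType (2 * (m + 1)) X (2 * (m + 1)) pq.1 pq.2 c) ∧
            2 ≤ S.card ∧ (∀ i ∈ S, b i = 1) ∧ ∃ i₀ ∈ S, (m + 1, m + 1) ∈ ajTypes b i₀) →
          ∀ e : complexBetti X (2 * (m + 1)), IsRationalClass e →
            IsOfHodgeType (2 * (m + 1)) X (2 * (m + 1)) (m + 1) (m + 1) e →
            (∀ x ∈ ((⨆ (W : Submodule D.E (Fin (2 * (m + 1) + 1) → D.E))
                (_ : IsTotallyPositive (conjRingHom D.E) D.H W) (_ : Module.finrank D.E W = m + 1),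
                classesSupportedOn X (D.specialSubvariety W) (2 * (m + 1))) ⊔
              (⨆ (W : Submodule D.E (Fin (2 * (m + 1) + 1) → D.E))
                (_ : IsTotallyPositive (conjRingHom D.E) D.H W) (_ : Module.finrank D.E W = m)
                (Z : Set X.left) (_ : IsClosed Z) (_ : Z ⊆ D.specialSubvariety W)
                (_ : ∀ z ∈ Z, ((m + 1 : ℕ) : ℕ∞) ≤ Order.coheight z),
                classesSupportedOn X Z (2 * (m + 1))) ⊔
              Submodule.span ℂ {z : complexBetti X (2 * (m + 1)) |
                ∃ a : complexBetti X (2 * m), IsRationalClass a ∧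
                  IsOfHodgeType (2 * (m + 1)) X (2 * m) m m a ∧
                  ∃ d ∈ algebraicClasses X 1,
                    z = cupProduct (two_mul_add_two_mul m 1) a d}),
              cupProduct (two_mul_add_two_mul (m + 1) (m + 1)) e x = 0) →
            ε e = 0 := by
  sorry

/-! ## Push–pull `[(f,g)₊1]_* = f₊ g^*` (= Literature `CorrespondenceActionOfGraph`, landed p92131; inlined until the
farm serves that module) and the Hecke operators as actions of algebraic classes — verbatim from line `IdeatorThreeSketch` -/

/-- **Push–pull for a graph class** (Fulton §16.1: the correspondence `(f, g)_*[S]` acts by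
`f_* ∘ g^*`). [cite: Fulton1998, §16.1 Prop. 16.1.1 and Def. 16.1.2] -/
theorem corrAction_gysinGraph_one {μ : OrientationFamily} (hμ : μ.HasPoincareDuality)
    {d n : ℕ} {S X : SchemeOver ℂ} (hS : IsSmoothProjective d S) (hX : IsSmoothProjective n X)
    (f g : S ⟶ X) {e a b : ℕ} (hde : d + e = n + n) (hab : a + 2 * e = b + 2 * n) :
    corrAction μ hX hX hab
        (complexGysin μ hS (IsSmoothProjective.tensor_holds hX hX) (lift f g)
          (show 0 + 2 * (n + n) = 2 * e + 2 * d by omega)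
          (singularCohomology.one ℂ (ComplexPoints S))) =
      complexGysin μ hS hX f (show a + 2 * n = b + 2 * d by omega) ∘ₗ (complexBetti.map g a).hom := by
  have hXX := IsSmoothProjective.tensor_holds hX hX
  refine LinearMap.ext fun β => ?_
  rw [corrAction_apply, LinearMap.comp_apply,
    ← complexGysin_cup hμ hS hXX (lift f g) (Nat.add_zero a)
      (show a + 2 * (n + n) = a + 2 * e + 2 * d by omega)
      (show 0 + 2 * (n + n) = 2 * e + 2 * d by omega) rfl
      (complexBetti.map (snd X X) a β) (singularCohomology.one ℂ (ComplexPoints S)),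
    cupProduct_one, ← CategoryTheory.comp_apply, ← complexBetti.map_comp, lift_snd,
    ← LinearMap.comp_apply (f := complexGysin μ hXX hX (fst X X) _),
    ← complexGysin_comp hμ hS hXX hX (lift f g) (fst X X)]
  simp only [lift_fst]

/-- **Graph classes are algebraic**: `(f, g)₊ 1 ∈ Nᵉ H^{2e}((X ⊗ X)(ℂ); ℂ)`.
[cite: FultonYoungTableaux1997, Appendix B §B.2 Exercise 5 and §B.3] -/
theorem gysinGraph_one_mem_algebraicClasses (μ : OrientationFamily) (hμ : μ.HasPoincareDuality)
    {d n : ℕ} {S X : SchemeOver ℂ} (hS : IsSmoothProjective d S) (hX : IsSmoothProjective n X) (f g : S ⟶ X)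
    {e : ℕ} (hde : d + e = n + n) :
    complexGysin μ hS (IsSmoothProjective.tensor_holds hX hX) (lift f g)
        (show 0 + 2 * (n + n) = 2 * e + 2 * d by omega)
        (singularCohomology.one ℂ (ComplexPoints S)) ∈ algebraicClasses (X ⊗ X) e :=
  complexGysin_mem_supportedClasses (gysinMap_restrictCompl_eq_zero_of_field ℂ) μ hμ hS
    (IsSmoothProjective.tensor_holds hX hX) (lift f g) _ (r := 0) (by omega)
    (by rw [supportedClasses_zero]; exact Submodule.mem_top)

/-- **Push–pull operators are actions of algebraic self-correspondences.**
[cite: Fulton1998, §16.1 Prop. 16.1.1 and Def. 16.1.2] -/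
theorem exists_algebraic_corrAction_eq_of_pushPull {μ : OrientationFamily} (hμ : μ.HasPoincareDuality)
    {n : ℕ} {X : SchemeOver ℂ} (hX : IsSmoothProjective n X) {a : ℕ} {T : complexBetti X a →ₗ[ℂ] complexBetti X a}
    (hT : ∃ (S : SchemeOver ℂ) (hS : IsSmoothProjective n S) (f g : S ⟶ X) (c : ℂ),
      T = c • (complexGysin μ hS hX f (rfl : a + 2 * n = a + 2 * n) ∘ₗ (complexBetti.map g a).hom)) :
    ∃ γ ∈ algebraicClasses (X ⊗ X) n,
      corrAction μ hX hX (rfl : a + 2 * n = a + 2 * n) γ = T := by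
  obtain ⟨S, hS, f, g, c, rfl⟩ := hT
  refine ⟨c • complexGysin μ hS (IsSmoothProjective.tensor_holds hX hX) (lift f g)
      (show 0 + 2 * (n + n) = 2 * n + 2 * n by omega)
      (singularCohomology.one ℂ (ComplexPoints S)),
    Submodule.smul_mem _ c (gysinGraph_one_mem_algebraicClasses μ hμ hS hX f g rfl), ?_⟩
  rw [map_smul, corrAction_gysinGraph_one hμ hS hX f g rfl rfl]

/-- **Non-admissible `g`: `T_g = 0 = P_0`.** [folklore] -/
theorem exists_algebraic_corrAction_eq_hecke_of_not (μ : OrientationFamily) {p : ℕ}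
    {X : SchemeOver ℂ} (D : UnitaryBallQuotientDatum p X) {g : GL (Fin (p + 1)) D.E}
    (hg : ¬ D.IsHeckeAdmissible g) (a : ℕ) :
    ∃ γ ∈ algebraicClasses (X ⊗ X) p,
      corrAction μ D.isSmoothProjective D.isSmoothProjective (rfl : a + 2 * p = a + 2 * p) γ =
        D.heckeCorrespondenceAction a g :=
  ⟨0, zero_mem _, by rw [map_zero, D.heckeCorrespondenceAction_of_not hg]⟩

/-- **`γ ∈ Γ`: `T_γ = 1 = P_{Δ₊ 1}`.** [cite: Fulton1998, §16.1 Prop. 16.1.1 and Def. 16.1.2] -/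
theorem exists_algebraic_corrAction_eq_hecke_of_mem {μ : OrientationFamily}
    (hμ : μ.HasPoincareDuality) {p : ℕ} {X : SchemeOver ℂ} (D : UnitaryBallQuotientDatum p X)
    {g : GL (Fin (p + 1)) D.E} (hg : g ∈ D.Γ) (a : ℕ) :
    ∃ γ ∈ algebraicClasses (X ⊗ X) p,
      corrAction μ D.isSmoothProjective D.isSmoothProjective (rfl : a + 2 * p = a + 2 * p) γ =
        D.heckeCorrespondenceAction a g := by
  refine exists_algebraic_corrAction_eq_of_pushPull hμ D.isSmoothProjective
    ⟨X, D.isSmoothProjective, 𝟙 X, 𝟙 X, 1, ?_⟩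
  rw [D.heckeCorrespondenceAction_of_mem hg, one_smul, complexGysin_id hμ D.isSmoothProjective a,
    complexBetti.map_id, ModuleCat.hom_id, LinearMap.id_comp]
  rfl

/-- **Hecke operators are actions of algebraic self-correspondences** (from Stub 1).
[cite: arXiv:1306.1515, Part 2 §1.8 and Thm 61] -/
theorem heckeGraphAlgebraic :
    ∀ (μ : OrientationFamily), μ.HasPoincareDuality →
      ∀ (m : ℕ) (X : SchemeOver ℂ) (D : UnitaryBallQuotientDatum (2 * (m + 1)) X), 1 ≤ m → m ≤ 2 →
        ∀ g : GL (Fin (2 * (m + 1) + 1)) D.E,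
          ∃ γ ∈ algebraicClasses (X ⊗ X) (2 * (m + 1)),
            corrAction μ D.isSmoothProjective D.isSmoothProjective
                (rfl : 2 * (m + 1) + 2 * (2 * (m + 1)) = 2 * (m + 1) + 2 * (2 * (m + 1))) γ =
              D.heckeCorrespondenceAction (2 * (m + 1)) g := by
  intro μ hμ m X D hm1 hm2 g
  by_cases hadm : D.IsHeckeAdmissible g
  · by_cases hg : g ∈ D.Γ
    · exact exists_algebraic_corrAction_eq_hecke_of_mem hμ D hg _
    · exact exists_algebraic_corrAction_eq_of_pushPull hμ D.isSmoothProjective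
        (stub_heckePushPull μ hμ m X D hm1 hm2 g hadm hg)
  · exact exists_algebraic_corrAction_eq_hecke_of_not μ D hadm _

/-! ## The Hecke algebra preserves Hodge types (from Stub 1 and the tree's PROVED Hodge-type calculus;
verbatim the sibling line `purity-sorted-hecke-envelope`'s derivation, rev 4) -/

/-- **Push–pull operators preserve every Hodge type.** For `μ` an orientation family, `S`, `X` smooth
projective of the SAME dimension `n`, `π π' : S ⟶ X`, `c ∈ ℂ`, and a class `x ∈ Hᵃ(X(ℂ); ℂ)` of type
`(p, q)`, the class `c • π₊ (π'^* x)` is again of type `(p, q)`: pull-backs preserve Hodge types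
(`IsOfHodgeType.map_of_independent`, a Hodge model of `S` exists by the PROVED `nonempty_hodgeModel_holds`)
and the Gysin morphism of an equidimensional morphism has bidegree `(0, 0)` (the tree's PROVED
`isOfHodgeType_complexGysin`). [cite: VoisinHodgeI2002, §7.3.2 (with Lemma 7.30)] -/
theorem isOfHodgeType_smul_gysin_map (μ : OrientationFamily) {n : ℕ} {S X : SchemeOver ℂ}
    (hS : IsSmoothProjective n S) (hX : IsSmoothProjective n X) (π π' : S ⟶ X) (c : ℂ)
    {a : ℕ} {p q : ℕ} {x : complexBetti X a} (hx : IsOfHodgeType n X a p q x) :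
    IsOfHodgeType n X a p q
      (c • complexGysin μ hS hX π (rfl : a + 2 * n = a + 2 * n) ((complexBetti.map π' a).hom x)) := by
  refine IsOfHodgeType.smul ?_ c
  have hpull : IsOfHodgeType n S a p q ((complexBetti.map π' a).hom x) :=
    hx.map_of_independent hodgePQ_independent_of_hodgeModel_holds hS hX
      (nonempty_hodgeModel_holds.nonempty hS).some π'
  exact isOfHodgeType_complexGysin hodgePQ_independent_of_hodgeModel_holds
    (fun _ _ ↦ nonempty_hodgeModel_holds)
    (fun E _ _ _ ↦ Literature.NumberTheory.Transcendental.exists_deRhamIsoFamily_holds (E := E))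
    μ hS hX π rfl (p := p) (q := q) rfl rfl hpull

/-- **The Hecke operators preserve every Hodge type** (KNOWN: the two projections of a Hecke
correspondence are local biholomorphisms, BMM Part 2 §1.8 / Thm. 61; here from Stub 1): `T_g x` is of
type `(p, q)` whenever `x` is. [cite: BergeronMillsonMoeglin2016Balls, Part 2 §1.8 and Thm. 61] -/
theorem isOfHodgeType_heckeCorrespondenceAction {μ : OrientationFamily} (hμ : μ.HasPoincareDuality)
    {m : ℕ} {X : SchemeOver ℂ} (D : UnitaryBallQuotientDatum (2 * (m + 1)) X) (hm1 : 1 ≤ m) (hm2 : m ≤ 2)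
    (g : GL (Fin (2 * (m + 1) + 1)) D.E) {p q : ℕ} {x : complexBetti X (2 * (m + 1))}
    (hx : IsOfHodgeType (2 * (m + 1)) X (2 * (m + 1)) p q x) :
    IsOfHodgeType (2 * (m + 1)) X (2 * (m + 1)) p q (D.heckeCorrespondenceAction (2 * (m + 1)) g x) := by
  by_cases hadm : D.IsHeckeAdmissible g
  · by_cases hg : g ∈ D.Γ
    · rw [D.heckeCorrespondenceAction_of_mem hg]
      exact hx
    · obtain ⟨S, hS, π, π', c, hT⟩ := stub_heckePushPull μ hμ m X D hm1 hm2 g hadm hg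
      rw [hT]
      exact isOfHodgeType_smul_gysin_map μ hS D.isSmoothProjective π π' c hx
  · rw [D.heckeCorrespondenceAction_of_not hadm, LinearMap.zero_apply, ← zero_smul ℂ x]
    exact hx.smul 0

/-- **The Hecke algebra preserves every Hodge type**: every element of
`𝓗 = Algebra.adjoin ℂ (range T_g)` maps classes of type `(p, q)` to classes of type `(p, q)`
(generators: `isOfHodgeType_heckeCorrespondenceAction`; scalars; sums and products:
`Algebra.adjoin_induction`). [cite: BergeronMillsonMoeglin2016Balls, Part 2 §1.8 and Thm. 61] -/
theorem heckeHodgeType {μ : OrientationFamily} (hμ : μ.HasPoincareDuality)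
    {m : ℕ} {X : SchemeOver ℂ} (D : UnitaryBallQuotientDatum (2 * (m + 1)) X) (hm1 : 1 ≤ m) (hm2 : m ≤ 2)
    {a : Module.End ℂ (complexBetti X (2 * (m + 1)))}
    (ha : a ∈ Algebra.adjoin ℂ (Set.range (D.heckeCorrespondenceAction (2 * (m + 1))))) {p q : ℕ} :
    ∀ x : complexBetti X (2 * (m + 1)), IsOfHodgeType (2 * (m + 1)) X (2 * (m + 1)) p q x →
      IsOfHodgeType (2 * (m + 1)) X (2 * (m + 1)) p q (a x) := by
  induction ha using Algebra.adjoin_induction with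
  | mem T hT =>
    obtain ⟨g, rfl⟩ := hT
    exact fun x hx ↦ isOfHodgeType_heckeCorrespondenceAction hμ D hm1 hm2 g hx
  | algebraMap r =>
    intro x hx
    rw [Module.algebraMap_end_apply]
    exact hx.smul r
  | add b b' _ _ ihb ihb' =>
    intro x hx
    rw [LinearMap.add_apply]
    exact (ihb x hx).add D.isSmoothProjective (ihb' x hx)
  | mul b b' _ _ ihb ihb' =>
    intro x hx
    rw [Module.End.mul_apply]
    exact ihb _ (ihb' x hx)

/-! ## R1 — the archimedean dictionary DERIVED (finding: its typed conjunction is Hodge bookkeeping) -/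

/-- **The planner's `stub_archDictionary`, now a theorem** (signature: the registered one, prefixed by an
orientation family with Poincaré duality, which the composition has at hand): every element of the Hecke
algebra preserves all Hodge types (`heckeHodgeType`, from Stub 1), so `stub_archDataOfHodgeStable`
supplies exact archimedean data. The idempotency / centrality / primitivity hypotheses are not used —
which is the finding R1. [cite: arXiv:1306.1515, §5 and Part 2 §§1.8–1.9] -/
theorem archDictionary (μ : OrientationFamily) (hμ : μ.HasPoincareDuality) :
    ∀ (m : ℕ) (X : SchemeOver ℂ) (D : UnitaryBallQuotientDatum (2 * (m + 1)) X), 1 ≤ m → m ≤ 2 →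
      ∀ z : Module.End ℂ (complexBetti X (2 * (m + 1))),
        z ∈ Algebra.adjoin ℂ (Set.range (D.heckeCorrespondenceAction (2 * (m + 1)))) →
        z * z = z →
        (∀ T ∈ Algebra.adjoin ℂ (Set.range (D.heckeCorrespondenceAction (2 * (m + 1)))), T * z = z * T) →
        z ≠ 0 →
        (∀ f ∈ Algebra.adjoin ℂ (Set.range (D.heckeCorrespondenceAction (2 * (m + 1)))), f * f = f →
          (∀ T ∈ Algebra.adjoin ℂ (Set.range (D.heckeCorrespondenceAction (2 * (m + 1)))), T * f = f * T) →
          f * z = 0 ∨ f * z = z) →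
        ∃ (r : ℕ) (b : Fin r → ℕ) (S : Finset (Fin r)),
          ((∑ k, b k = 2 * (m + 1) + 1) ∧ (∀ i ∈ S, ∀ j ∈ S, b i = b j) ∧
          LinearMap.range z ≤ Submodule.span ℂ {c : complexBetti X (2 * (m + 1)) |
            ∃ pq ∈ ajTypesOf b S (2 * (m + 1)), IsOfHodgeType (2 * (m + 1)) X (2 * (m + 1)) pq.1 pq.2 c} ∧
          ∀ pq ∈ ajTypesOf b S (2 * (m + 1)), ∃ c ∈ LinearMap.range z, c ≠ 0 ∧
            IsOfHodgeType (2 * (m + 1)) X (2 * (m + 1)) pq.1 pq.2 c) :=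
  fun m X D hm1 hm2 z hz _ _ _ _ ↦
    stub_archDataOfHodgeStable m X D.isSmoothProjective z (fun _ _ c hc ↦ heckeHodgeType hμ D hm1 hm2 hz c hc)

/-! ## R2 — the sieve DERIVED: Hodge directness + the ℚ-descent lemma -/

/-- The pieces `H^{p,q}`, `p + q = k`, of a Hodge model are independent in `Hᵏ(X^an; ℂ)` (field
`isInternal_hodgePQ`, transported along the de Rham comparison). [cite: VoisinHodgeI2002, Thm. 6.18 and Cor. 6.14] -/
theorem typeKill_iSupIndep_hodgePQ {n : ℕ} {X : SchemeOver ℂ} (A : HodgeModel n X) (k : ℕ) :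
    iSupIndep fun pq : ↥(Finset.HasAntidiagonal.antidiagonal k) ↦ A.hodgePQ k pq.1.1 pq.1.2 :=
  (iSupIndep_map_orderIso_iff (Submodule.orderIsoMapComap (A.deRham A.carrier k))).2
    (A.isInternal_hodgePQ k).submodule_iSupIndep

/-- In a Hodge model, `H^{p,q} ⊆ Hᵏ` is `⊥` unless `p + q = k`. [folklore] -/
theorem typeKill_hodgePQ_eq_bot_of_ne {n : ℕ} {X : SchemeOver ℂ} (A : HodgeModel n X) {k p q : ℕ}
    (h : p + q ≠ k) : A.hodgePQ k p q = ⊥ := by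
  rw [HodgeModel.hodgePQ, Literature.NumberTheory.Transcendental.hodgePQ_eq_bot_of_ne (M := A.carrier) h,
    Submodule.map_bot]

/-- **Directness of the Hodge decomposition kills the `(n,n)`-part of a type-avoiding piece.** If `z`
preserves the type `(n,n)` and its image is spanned by classes of finitely many types all `≠ (n,n)`,
then `z` kills EVERY class of type `(n,n)` (read all types in one Hodge model `A`,
`hodgePQ_independent_of_hodgeModel_holds.isOfHodgeType_iff`; the pieces `H^{p,q}`, `p + q = 2n`, are
independent, `HodgeModel.isInternal_hodgePQ`; types of the wrong degree are `⊥`).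
[cite: VoisinHodgeI2002, Thm. 6.18 and Cor. 6.14] -/
theorem typeKill {m : ℕ} {X : SchemeOver ℂ} (hX : IsSmoothProjective (2 * (m + 1)) X)
    {z : Module.End ℂ (complexBetti X (2 * (m + 1)))}
    (hz : ∀ c, IsOfHodgeType (2 * (m + 1)) X (2 * (m + 1)) (m + 1) (m + 1) c →
      IsOfHodgeType (2 * (m + 1)) X (2 * (m + 1)) (m + 1) (m + 1) (z c))
    (hT : ∃ T : Finset (ℕ × ℕ), (m + 1, m + 1) ∉ T ∧
      LinearMap.range z ≤ Submodule.span ℂ {c : complexBetti X (2 * (m + 1)) |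
        ∃ pq ∈ T, IsOfHodgeType (2 * (m + 1)) X (2 * (m + 1)) pq.1 pq.2 c})
    {c : complexBetti X (2 * (m + 1))} (hc : IsOfHodgeType (2 * (m + 1)) X (2 * (m + 1)) (m + 1) (m + 1) c) :
    z c = 0 := by
  classical
  obtain ⟨T, hnn, hrange⟩ := hT
  obtain ⟨A, hA⟩ := hc
  have hI := hodgePQ_independent_of_hodgeModel_holds
  have h1 : A.pullback (2 * (m + 1)) (z c) ∈ A.hodgePQ (2 * (m + 1)) (m + 1) (m + 1) :=
    (hI.isOfHodgeType_iff hX A).1 (hz c ⟨A, hA⟩)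
  let i0 : ↥(Finset.HasAntidiagonal.antidiagonal (2 * (m + 1))) :=
    ⟨(m + 1, m + 1), Finset.HasAntidiagonal.mem_antidiagonal.2 (two_mul (m + 1)).symm⟩
  have h2 : A.pullback (2 * (m + 1)) (z c) ∈
      ⨆ (j : ↥(Finset.HasAntidiagonal.antidiagonal (2 * (m + 1)))) (_ : j ≠ i0), A.hodgePQ (2 * (m + 1)) j.1.1 j.1.2 := by
    have key : Submodule.span ℂ {c : complexBetti X (2 * (m + 1)) |
          ∃ pq ∈ T, IsOfHodgeType (2 * (m + 1)) X (2 * (m + 1)) pq.1 pq.2 c} ≤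
        (⨆ (j : ↥(Finset.HasAntidiagonal.antidiagonal (2 * (m + 1)))) (_ : j ≠ i0),
          A.hodgePQ (2 * (m + 1)) j.1.1 j.1.2).comap (A.pullback (2 * (m + 1))).hom := by
      refine Submodule.span_le.2 ?_
      rintro c' ⟨pq, hpq, hc'⟩
      have hc'' : A.pullback (2 * (m + 1)) c' ∈ A.hodgePQ (2 * (m + 1)) pq.1 pq.2 :=
        (hI.isOfHodgeType_iff hX A).1 hc'
      rw [SetLike.mem_coe, Submodule.mem_comap]
      by_cases hdeg : pq.1 + pq.2 = 2 * (m + 1)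
      · have hj : (⟨pq, Finset.HasAntidiagonal.mem_antidiagonal.2 hdeg⟩ : ↥(Finset.HasAntidiagonal.antidiagonal (2 * (m + 1)))) ≠ i0 := by
          intro h
          apply hnn
          have h' : pq = (m + 1, m + 1) := congrArg Subtype.val h
          rw [← h']
          exact hpq
        exact (le_iSup₂_of_le (f := fun (j : ↥(Finset.HasAntidiagonal.antidiagonal (2 * (m + 1)))) (_ : j ≠ i0) ↦
          A.hodgePQ (2 * (m + 1)) j.1.1 j.1.2) ⟨pq, Finset.HasAntidiagonal.mem_antidiagonal.2 hdeg⟩ hj le_rfl) hc''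
      · rw [typeKill_hodgePQ_eq_bot_of_ne A hdeg, Submodule.mem_bot] at hc''
        change (A.pullback (2 * (m + 1))) c' ∈ _
        rw [hc'']
        exact Submodule.zero_mem _
    exact key (hrange (LinearMap.mem_range_self z c))
  have hdisj := (typeKill_iSupIndep_hodgePQ A (2 * (m + 1))) i0
  rw [Submodule.disjoint_def] at hdisj
  have h0 : A.pullback (2 * (m + 1)) (z c) = 0 := hdisj _ h1 h2
  exact A.pullback_injective (2 * (m + 1)) (by rw [h0, map_zero])


/-! ## The ℚ-descent lemma: helpers -/

section Descent

variable {k : ℕ} {X : SchemeOver ℂ}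

/-- Rational-preserving operators: `ℚ`-combinations of rational-preserving operators are
rational-preserving. [cite: HatcherAT2002, §3.1 p. 198] -/
theorem descent_rp_sum_smul {ι : Type*} (s : Finset ι) {T : ι → Module.End ℂ (complexBetti X k)}
    (hT : ∀ i, ∀ β, IsRationalClass β → IsRationalClass (T i β)) (q : ι → ℚ) :
    ∀ β, IsRationalClass β → IsRationalClass ((∑ i ∈ s, ((q i : ℚ) : ℂ) • T i) β) := by
  intro β hβ
  rw [LinearMap.sum_apply]
  simp only [LinearMap.smul_apply]
  exact IsRationalClass.sum_smul s (fun i ↦ hT i β hβ) q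

/-- Products of rational-preserving operators are rational-preserving. [folklore] -/
theorem descent_rp_mul {S T : Module.End ℂ (complexBetti X k)}
    (hS : ∀ β, IsRationalClass β → IsRationalClass (S β))
    (hT : ∀ β, IsRationalClass β → IsRationalClass (T β)) :
    ∀ β, IsRationalClass β → IsRationalClass ((S * T) β) :=
  fun β hβ ↦ hS _ (hT β hβ)

/-- Differences of rational classes are rational. [cite: HatcherAT2002, §3.1 p. 198] -/
theorem descent_isRationalClass_sub {a b : complexBetti X k} (ha : IsRationalClass a)
    (hb : IsRationalClass b) : IsRationalClass (a - b) := by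
  have h := ha.add (hb.smul (-1))
  simpa [sub_eq_add_neg] using h

/-- The monomials in the Hecke operators are rational-preserving (the generators are,
`isRationalClass_heckeCorrespondenceAction`; closure under products). [cite: BergeronMillsonMoeglin2016Balls, Part 2 §1.9] -/
theorem descent_rp_of_mem_closure {p : ℕ} (D : UnitaryBallQuotientDatum p X)
    {T : Module.End ℂ (complexBetti X k)}
    (hT : T ∈ Submonoid.closure (Set.range (D.heckeCorrespondenceAction k))) :
    ∀ β, IsRationalClass β → IsRationalClass (T β) := by
  induction hT using Submonoid.closure_induction with
  | mem T hT =>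
    obtain ⟨g, rfl⟩ := hT
    exact fun β hβ ↦ D.isRationalClass_heckeCorrespondenceAction k g hβ
  | one => exact fun β hβ ↦ hβ
  | mul S T _ _ ihS ihT => exact descent_rp_mul ihS ihT

/-- **A finite rational-preserving spanning family of the Hecke algebra**: `𝓗 = adjoin ℂ (range T_g)`
is the ℂ-span of the monomials in the `T_g` (`Algebra.adjoin_eq_span`), a finite-dimensional space
(`X` smooth projective), so finitely many monomials span it. [cite: BergeronMillsonMoeglin2016Balls, Part 2 §1.9] -/
theorem descent_exists_spanning_monomials {n p : ℕ} (hX : IsSmoothProjective n X)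
    (D : UnitaryBallQuotientDatum p X) :
    ∃ (P : ℕ) (μ : Fin P → Module.End ℂ (complexBetti X k)),
      (∀ a, μ a ∈ Algebra.adjoin ℂ (Set.range (D.heckeCorrespondenceAction k))) ∧
      (∀ a, ∀ β, IsRationalClass β → IsRationalClass (μ a β)) ∧
      Submodule.span ℂ (Set.range μ) =
        Subalgebra.toSubmodule (Algebra.adjoin ℂ (Set.range (D.heckeCorrespondenceAction k))) := by
  classical
  haveI := finite_complexBetti hX k
  set M : Set (Module.End ℂ (complexBetti X k)) :=
    (Submonoid.closure (Set.range (D.heckeCorrespondenceAction k)) : Set (Module.End ℂ (complexBetti X k)))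
  obtain ⟨b, hbM, hbspan, hbli⟩ := exists_linearIndependent ℂ M
  have hbfin : b.Finite := hbli.set_finite_of_isNoetherian
  haveI : Fintype b := hbfin.fintype
  let e : b ≃ Fin (Fintype.card b) := Fintype.equivFin b
  refine ⟨Fintype.card b, fun a ↦ (e.symm a : Module.End ℂ (complexBetti X k)), ?_, ?_, ?_⟩
  · intro a
    have hmem : ((e.symm a : b) : Module.End ℂ (complexBetti X k)) ∈ M := hbM (e.symm a).2
    exact (Submonoid.closure_le (S := (Algebra.adjoin ℂ
      (Set.range (D.heckeCorrespondenceAction k))).toSubmonoid)).2 Algebra.subset_adjoin hmem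
  · intro a
    exact descent_rp_of_mem_closure D (hbM (e.symm a).2)
  · have hrange : Set.range (fun a ↦ ((e.symm a : b) : Module.End ℂ (complexBetti X k))) = b := by
      ext T
      constructor
      · rintro ⟨a, rfl⟩
        exact (e.symm a).2
      · intro hT
        exact ⟨e ⟨T, hT⟩, by simp⟩
    rw [hrange, hbspan, Algebra.adjoin_eq_span]

/-- **A finite rational spanning family of `Hᵏ(X(ℂ); ℂ)`** (`X` smooth projective: the rational
classes span, `span_isRationalClass_eq_top_of_isSmoothProjective_holds`, and the space is
finite-dimensional). [cite: VoisinHodgeI2002, §7.1.1] -/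
theorem descent_exists_rational_spanning {n : ℕ} (hX : IsSmoothProjective n X) :
    ∃ (Q : ℕ) (x : Fin Q → complexBetti X k), (∀ d, IsRationalClass (x d)) ∧
      Submodule.span ℂ (Set.range x) = ⊤ := by
  classical
  haveI := finite_complexBetti hX k
  obtain ⟨b, hbM, hbspan, hbli⟩ :=
    exists_linearIndependent ℂ {c : complexBetti X k | IsRationalClass c}
  have hbfin : b.Finite := hbli.set_finite_of_isNoetherian
  haveI : Fintype b := hbfin.fintype
  let e : b ≃ Fin (Fintype.card b) := Fintype.equivFin b
  refine ⟨Fintype.card b, fun d ↦ (e.symm d : complexBetti X k), fun d ↦ hbM (e.symm d).2, ?_⟩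
  have hrange : Set.range (fun d ↦ ((e.symm d : b) : complexBetti X k)) = b := by
    ext c
    constructor
    · rintro ⟨d, rfl⟩
      exact (e.symm d).2
    · intro hc
      exact ⟨e ⟨c, hc⟩, by simp⟩
  rw [hrange, hbspan, span_isRationalClass_eq_top_of_isSmoothProjective_holds n X hX k]


/-! ### ℚ-spanned subspaces of `ℂ^P` -/

/-- `ℂ^P` itself is ℚ-spanned (the standard basis vectors are rational). [folklore] -/
theorem descent_ratSpanned_top (P : ℕ) :
    (⊤ : Submodule ℂ (Fin P → ℂ)) ≤ Submodule.span ℂ {c : Fin P → ℂ |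
      c ∈ (⊤ : Submodule ℂ (Fin P → ℂ)) ∧ ∃ q : Fin P → ℚ, c = fun i ↦ (q i : ℂ)} := by
  classical
  intro c _
  rw [pi_eq_sum_univ c]
  refine Submodule.sum_mem _ fun a _ ↦ Submodule.smul_mem _ _ (Submodule.subset_span ⟨Submodule.mem_top, ?_⟩)
  refine ⟨fun j ↦ if a = j then 1 else 0, ?_⟩
  funext j
  by_cases h : a = j
  · simp [h]
  · simp [h]

/-- Finite intersections of ℚ-spanned subspaces of `ℂ^P` are ℚ-spanned (`stub_ratSpannedInf`,
by induction). [folklore] -/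
theorem descent_ratSpanned_finset_inf {P : ℕ} {ι : Type*} (s : Finset ι)
    (W : ι → Submodule ℂ (Fin P → ℂ))
    (hW : ∀ i ∈ s, W i ≤ Submodule.span ℂ {c : Fin P → ℂ | c ∈ W i ∧ ∃ q : Fin P → ℚ, c = fun i ↦ (q i : ℂ)}) :
    s.inf W ≤ Submodule.span ℂ {c : Fin P → ℂ | c ∈ s.inf W ∧ ∃ q : Fin P → ℚ, c = fun i ↦ (q i : ℂ)} := by
  classical
  induction s using Finset.induction_on with
  | empty =>
    rw [Finset.inf_empty]
    exact descent_ratSpanned_top P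
  | insert a s ha ih =>
    rw [Finset.inf_insert]
    exact stub_ratSpannedInf P (W a) (s.inf W) (hW a (Finset.mem_insert_self a s))
      (ih fun i hi ↦ hW i (Finset.mem_insert_of_mem hi))

/-! ### S1 — ℚ-descent of the centre of the Hecke algebra -/

/-- **The centre of the Hecke algebra is ℚ-spanned**: a central element `z` of
`𝓗 = adjoin ℂ (range T_g)` is a ℂ-combination of RATIONAL-PRESERVING central elements of `𝓗`.
Proof: write `z = Σ_a c_a μ_a` over a finite rational-preserving spanning family of monomials
(`descent_exists_spanning_monomials`); centrality is the finite system of ℚ-linear equations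
`Σ_a c_a (μ_a μ_b - μ_b μ_a)(x_d) = 0` over a finite rational spanning family `(x_d)` of `H`
(`descent_exists_rational_spanning`), whose complex solution space is ℚ-spanned
(`stub_rationalRelations` for each equation, `stub_ratSpannedInf` for the intersection); every
rational solution `q` gives the rational-preserving central element `Σ_a q_a μ_a`.
[cite: BergeronMillsonMoeglin2016Balls, Part 2 §1.9] -/
theorem descent_center {n p : ℕ} (hX : IsSmoothProjective n X) (D : UnitaryBallQuotientDatum p X)
    {z : Module.End ℂ (complexBetti X k)}
    (hz1 : z ∈ Algebra.adjoin ℂ (Set.range (D.heckeCorrespondenceAction k)))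
    (hz3 : ∀ T ∈ Algebra.adjoin ℂ (Set.range (D.heckeCorrespondenceAction k)), T * z = z * T) :
    ∃ (I : ℕ) (r : Fin I → Module.End ℂ (complexBetti X k)) (cz : Fin I → ℂ),
      (∀ i, r i ∈ Algebra.adjoin ℂ (Set.range (D.heckeCorrespondenceAction k))) ∧
      (∀ i, ∀ T ∈ Algebra.adjoin ℂ (Set.range (D.heckeCorrespondenceAction k)), T * r i = r i * T) ∧
      (∀ i, ∀ β, IsRationalClass β → IsRationalClass (r i β)) ∧
      z = ∑ i, cz i • r i := by
  classical
  obtain ⟨P, μ, hμA, hμrp, hμspan⟩ := descent_exists_spanning_monomials (k := k) hX D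
  obtain ⟨Q, x, hxrat, hxspan⟩ := descent_exists_rational_spanning (k := k) hX
  -- coefficients of `z` on the spanning family
  have hzspan : z ∈ Submodule.span ℂ (Set.range μ) := by
    rw [hμspan]; exact hz1
  obtain ⟨c, hc⟩ := (Submodule.mem_span_range_iff_exists_fun ℂ).1 hzspan
  -- the rational constraint vectors and their solution spaces
  let w : Fin P × Fin Q → Fin P → complexBetti X k :=
    fun π a ↦ (μ a * μ π.1 - μ π.1 * μ a) (x π.2)
  have hwrat : ∀ π a, IsRationalClass (w π a) := fun π a ↦
    descent_isRationalClass_sub (hμrp a _ (hμrp π.1 _ (hxrat π.2)))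
      (hμrp π.1 _ (hμrp a _ (hxrat π.2)))
  let S : Fin P × Fin Q → Submodule ℂ (Fin P → ℂ) :=
    fun π ↦ LinearMap.ker (Fintype.linearCombination ℂ (w π))
  have hSmem : ∀ π (c' : Fin P → ℂ), c' ∈ S π ↔ ∑ a, c' a • w π a = 0 := fun π c' ↦ by
    simp only [S, LinearMap.mem_ker, Fintype.linearCombination_apply]
  have hSrat : ∀ π ∈ (Finset.univ : Finset (Fin P × Fin Q)), S π ≤ Submodule.span ℂ
      {c' : Fin P → ℂ | c' ∈ S π ∧ ∃ q : Fin P → ℚ, c' = fun i ↦ (q i : ℂ)} := by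
    intro π _ c' hc'
    have h := stub_rationalRelations X k P (w π) (hwrat π) c' ((hSmem π c').1 hc')
    refine Submodule.span_mono ?_ h
    rintro c'' ⟨hq, hrel⟩
    exact ⟨(hSmem π c'').2 hrel, hq⟩
  -- the commutator identity `Σ_a c'_a (μ_a μ_b - μ_b μ_a) = (Σ c'_a μ_a) μ_b - μ_b (Σ c'_a μ_a)`
  have hcommutator : ∀ (c' : Fin P → ℂ) (b : Fin P),
      ∑ a, c' a • (μ a * μ b - μ b * μ a) = (∑ a, c' a • μ a) * μ b - μ b * ∑ a, c' a • μ a := by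
    intro c' b
    rw [Finset.sum_mul, Finset.mul_sum, ← Finset.sum_sub_distrib]
    refine Finset.sum_congr rfl fun a _ ↦ ?_
    rw [smul_sub, smul_mul_assoc, mul_smul_comm]
  -- `c` solves every constraint (centrality of `z`)
  have hcS : c ∈ (Finset.univ : Finset (Fin P × Fin Q)).inf S := by
    refine (Submodule.mem_finsetInf).2 fun π _ ↦ ?_
    rw [hSmem]
    have key := hcommutator c π.1
    rw [hc, ← hz3 _ (hμA π.1), sub_self] at key
    have h := congrArg (fun T : Module.End ℂ (complexBetti X k) ↦ T (x π.2)) key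
    simpa only [LinearMap.sum_apply, LinearMap.smul_apply, LinearMap.zero_apply] using h
  -- hence `c` is a combination of RATIONAL common solutions
  have hrat := descent_ratSpanned_finset_inf Finset.univ S hSrat hcS
  rw [Submodule.mem_span_set'] at hrat
  obtain ⟨I, lam, g, hsum⟩ := hrat
  have hg : ∀ i, (g i : Fin P → ℂ) ∈ (Finset.univ : Finset (Fin P × Fin Q)).inf S ∧
      ∃ q : Fin P → ℚ, (g i : Fin P → ℂ) = fun a ↦ (q a : ℂ) := fun i ↦ (g i).2
  choose q hq using fun i ↦ (hg i).2
  refine ⟨I, fun i ↦ ∑ a, ((q i a : ℚ) : ℂ) • μ a, lam, ?_, ?_, ?_, ?_⟩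
  · intro i
    exact Subalgebra.sum_mem _ fun a _ ↦ Subalgebra.smul_mem _ (hμA a) _
  · -- centrality: the rational solution commutes with every `μ b`, hence with their span `𝓗`
    intro i T hT
    have hcommb : ∀ b, (∑ a, ((q i a : ℚ) : ℂ) • μ a) * μ b = μ b * ∑ a, ((q i a : ℚ) : ℂ) • μ a := by
      intro b
      have hΔ : ∑ a, ((q i a : ℚ) : ℂ) • (μ a * μ b - μ b * μ a) = 0 := by
        refine LinearMap.ext_on_range hxspan fun d ↦ ?_
        have hmem := (Submodule.mem_finsetInf.1 (hg i).1) (b, d) (Finset.mem_univ _)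
        rw [hSmem, hq i] at hmem
        simpa only [LinearMap.sum_apply, LinearMap.smul_apply, LinearMap.zero_apply] using hmem
      rw [hcommutator] at hΔ
      exact sub_eq_zero.1 hΔ
    have hTspan : T ∈ Submodule.span ℂ (Set.range μ) := by
      rw [hμspan]; exact hT
    obtain ⟨t, ht⟩ := (Submodule.mem_span_range_iff_exists_fun ℂ).1 hTspan
    rw [← ht, Finset.sum_mul, Finset.mul_sum]
    refine Finset.sum_congr rfl fun b _ ↦ ?_
    rw [smul_mul_assoc, mul_smul_comm, hcommb b]
  · intro i
    exact descent_rp_sum_smul _ (fun a ↦ hμrp a) (q i)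
  · -- `z = Σ_i lam_i • r_i`
    have hca : ∀ a, c a = ∑ i, lam i * ((q i a : ℚ) : ℂ) := by
      intro a
      have h := congrArg (fun f : Fin P → ℂ ↦ f a) hsum
      simp only [Finset.sum_apply, Pi.smul_apply, smul_eq_mul] at h
      rw [← h]
      refine Finset.sum_congr rfl fun i _ ↦ ?_
      rw [hq i]
    rw [← hc]
    simp_rw [hca, Finset.sum_smul, mul_smul, Finset.smul_sum]
    exact Finset.sum_comm

/-! ### S2–S4 — the ℚ-descent lemma -/

/-- Powers of a rational-preserving operator are rational-preserving. [folklore] -/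
theorem descent_rp_pow {j : Module.End ℂ (complexBetti X k)}
    (hj : ∀ β, IsRationalClass β → IsRationalClass (j β)) :
    ∀ (i : ℕ) β, IsRationalClass β → IsRationalClass ((j ^ i) β)
  | 0, β, hβ => by simpa using hβ
  | i + 1, β, hβ => by
    rw [pow_succ, Module.End.mul_apply]
    exact descent_rp_pow hj i _ (hj β hβ)

/-- A ℚ-polynomial in a rational-preserving operator is rational-preserving. [folklore] -/
theorem descent_rp_aeval {j : Module.End ℂ (complexBetti X k)}
    (hj : ∀ β, IsRationalClass β → IsRationalClass (j β)) (P : Polynomial ℚ) :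
    ∀ β, IsRationalClass β → IsRationalClass (Polynomial.aeval j (P.map (algebraMap ℚ ℂ)) β) := by
  intro β hβ
  rw [Polynomial.aeval_eq_sum_range, LinearMap.sum_apply]
  have h : ∀ i ∈ Finset.range ((P.map (algebraMap ℚ ℂ)).natDegree + 1),
      ((P.map (algebraMap ℚ ℂ)).coeff i • j ^ i) β = ((P.coeff i : ℚ) : ℂ) • (j ^ i) β := by
    intro i _
    rw [LinearMap.smul_apply, Polynomial.coeff_map]
    rfl
  rw [Finset.sum_congr rfl h]
  exact IsRationalClass.sum_smul _ (fun i ↦ descent_rp_pow hj i β hβ) _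

/-- A polynomial in `j` lies in every subalgebra containing `j`. [folklore] -/
theorem descent_aeval_mem {A : Subalgebra ℂ (Module.End ℂ (complexBetti X k))}
    {j : Module.End ℂ (complexBetti X k)} (hj : j ∈ A) (P : Polynomial ℂ) :
    Polynomial.aeval j P ∈ A := by
  rw [Polynomial.aeval_eq_sum_range]
  exact Subalgebra.sum_mem _ fun i _ ↦ Subalgebra.smul_mem _ (Subalgebra.pow_mem _ hj i) _

/-- Anything commuting with `j` commutes with every polynomial in `j`. [folklore] -/
theorem descent_commute_aeval {T j : Module.End ℂ (complexBetti X k)} (h : T * j = j * T)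
    (P : Polynomial ℂ) : T * Polynomial.aeval j P = Polynomial.aeval j P * T := by
  have hc : Commute T j := h
  rw [Polynomial.aeval_eq_sum_range, Finset.mul_sum, Finset.sum_mul]
  refine Finset.sum_congr rfl fun i _ ↦ ?_
  rw [mul_smul_comm, smul_mul_assoc, (hc.pow_right i).eq]

/-- **THE ℚ-DESCENT LEMMA for ℚ-blocks of the Hecke algebra.** Let `𝓗 = Algebra.adjoin ℂ (range T_g)`
on `H = Hᵏ(X(ℂ); ℂ)` (`X` smooth projective), `ε` a ℚ-BLOCK (central idempotent of `𝓗` preserving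
rational classes, primitive among the rational-preserving central idempotents) and `z` a central
idempotent of `𝓗` with `z ε = z`, `z ≠ 0`. If `z` kills a RATIONAL class `e`, then `ε e = 0`.
Proof: (S1) the centre of `𝓗` is ℚ-spanned (`descent_center`); (S2–S3) writing `z = Σ cᵢ rᵢ ε` with
`rᵢ` rational-preserving central and using `z (ε e) = 0`, the coefficient vector is a combination of
rational relations among the rational classes `rᵢ ε (ε e)` (`stub_rationalRelations`), so `z` lies in
the ℂ-span of `J = {j rational-preserving central, j ε = j, j (ε e) = 0}`; (S4) `J` is not nil (a
commuting family of nilpotents spans only nilpotents, and `z` is a non-zero idempotent), so some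
`j ∈ J` is not nilpotent and `stub_rationalFitting` gives a non-zero idempotent `f = p(j) j`: it is
central, rational-preserving, `f ε = f`, `f (ε e) = 0`; primitivity of `ε` forces `f = ε`, whence
`ε e = 0`. No `Aut(ℂ)`-orbit argument is used. [cite: BergeronMillsonMoeglin2016Balls, Part 2 §1.9] -/
theorem rationalBlockDescent {n : ℕ} (hX : IsSmoothProjective n X)
    {p : ℕ} (D : UnitaryBallQuotientDatum p X)
    {ε : Module.End ℂ (complexBetti X k)}
    (h1 : ε ∈ Algebra.adjoin ℂ (Set.range (D.heckeCorrespondenceAction k)))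
    (h2 : ε * ε = ε)
    (h3 : ∀ T ∈ Algebra.adjoin ℂ (Set.range (D.heckeCorrespondenceAction k)), T * ε = ε * T)
    (h4 : ∀ β, IsRationalClass β → IsRationalClass (ε β))
    (h5 : ∀ f ∈ Algebra.adjoin ℂ (Set.range (D.heckeCorrespondenceAction k)), f * f = f →
      (∀ T ∈ Algebra.adjoin ℂ (Set.range (D.heckeCorrespondenceAction k)), T * f = f * T) →
      (∀ β, IsRationalClass β → IsRationalClass (f β)) → f * ε = 0 ∨ f * ε = ε)
    {z : Module.End ℂ (complexBetti X k)}
    (hz1 : z ∈ Algebra.adjoin ℂ (Set.range (D.heckeCorrespondenceAction k)))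
    (hz2 : z * z = z)
    (hz3 : ∀ T ∈ Algebra.adjoin ℂ (Set.range (D.heckeCorrespondenceAction k)), T * z = z * T)
    (hz0 : z ≠ 0) (hzε : z * ε = z)
    {e : complexBetti X k} (he : IsRationalClass e) (hze : z e = 0) : ε e = 0 := by
  classical
  set 𝓐 := Algebra.adjoin ℂ (Set.range (D.heckeCorrespondenceAction k)) with h𝓐
  -- S0: replace `e` by `e' := ε e`
  set e' := ε e with he'def
  have he' : IsRationalClass e' := h4 e he
  have hze' : z e' = 0 := by
    rw [he'def, ← Module.End.mul_apply, hzε, hze]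
  have hεe' : ε e' = e' := by
    rw [he'def, ← Module.End.mul_apply, h2]
  -- S1: `z = Σ cz i • r i` with `r i` rational-preserving central; replace `r i` by `r i * ε`
  obtain ⟨I, r, cz, hrA, hrc, hrrp, hzsum⟩ := descent_center (k := k) hX D hz1 hz3
  let r' : Fin I → Module.End ℂ (complexBetti X k) := fun i ↦ r i * ε
  have hr'A : ∀ i, r' i ∈ 𝓐 := fun i ↦ Subalgebra.mul_mem _ (hrA i) h1
  have hr'c : ∀ i, ∀ T ∈ 𝓐, T * r' i = r' i * T := fun i T hT ↦ by
    change T * (r i * ε) = r i * ε * T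
    rw [← mul_assoc, hrc i T hT, mul_assoc, h3 T hT, mul_assoc]
  have hr'rp : ∀ i, ∀ β, IsRationalClass β → IsRationalClass (r' i β) :=
    fun i ↦ descent_rp_mul (hrrp i) h4
  have hr'ε : ∀ i, r' i * ε = r' i := fun i ↦ by
    change r i * ε * ε = r i * ε
    rw [mul_assoc, h2]
  have hzsum' : z = ∑ i, cz i • r' i := by
    rw [← hzε, hzsum, Finset.sum_mul]
    refine Finset.sum_congr rfl fun i _ ↦ ?_
    rw [smul_mul_assoc]
  -- S2–S3: `z` is a combination of rational-preserving central `j` with `j ε = j`, `j e' = 0`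
  have hrel : ∑ i, cz i • (r' i e') = 0 := by
    have h := congrArg (fun T : Module.End ℂ (complexBetti X k) ↦ T e') hzsum'
    simp only [LinearMap.sum_apply, LinearMap.smul_apply] at h
    rw [← h, hze']
  have hmem := stub_rationalRelations X k I (fun i ↦ r' i e') (fun i ↦ hr'rp i _ he') cz hrel
  rw [Submodule.mem_span_set'] at hmem
  obtain ⟨L, lam, g, hsum⟩ := hmem
  have hg : ∀ l, (∃ q : Fin I → ℚ, (g l : Fin I → ℂ) = fun i ↦ (q i : ℂ)) ∧
      ∑ i, (g l : Fin I → ℂ) i • r' i e' = 0 := fun l ↦ (g l).2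
  choose q hq using fun l ↦ (hg l).1
  let jj : Fin L → Module.End ℂ (complexBetti X k) := fun l ↦ ∑ i, ((q l i : ℚ) : ℂ) • r' i
  have hjjA : ∀ l, jj l ∈ 𝓐 := fun l ↦
    Subalgebra.sum_mem _ fun i _ ↦ Subalgebra.smul_mem _ (hr'A i) _
  have hjjc : ∀ l, ∀ T ∈ 𝓐, T * jj l = jj l * T := fun l T hT ↦ by
    change T * (∑ i, ((q l i : ℚ) : ℂ) • r' i) = (∑ i, ((q l i : ℚ) : ℂ) • r' i) * T
    rw [Finset.mul_sum, Finset.sum_mul]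
    refine Finset.sum_congr rfl fun i _ ↦ ?_
    rw [mul_smul_comm, smul_mul_assoc, hr'c i T hT]
  have hjjrp : ∀ l, ∀ β, IsRationalClass β → IsRationalClass (jj l β) :=
    fun l ↦ descent_rp_sum_smul _ (fun i ↦ hr'rp i) (q l)
  have hjjε : ∀ l, jj l * ε = jj l := fun l ↦ by
    change (∑ i, ((q l i : ℚ) : ℂ) • r' i) * ε = ∑ i, ((q l i : ℚ) : ℂ) • r' i
    rw [Finset.sum_mul]
    refine Finset.sum_congr rfl fun i _ ↦ ?_
    rw [smul_mul_assoc, hr'ε i]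
  have hjje' : ∀ l, jj l e' = 0 := fun l ↦ by
    have h := (hg l).2
    rw [hq l] at h
    change (∑ i, ((q l i : ℚ) : ℂ) • r' i) e' = 0
    simpa only [LinearMap.sum_apply, LinearMap.smul_apply] using h
  have hzjj : z = ∑ l, lam l • jj l := by
    have hca : ∀ i, cz i = ∑ l, lam l * ((q l i : ℚ) : ℂ) := by
      intro i
      have h := congrArg (fun f : Fin I → ℂ ↦ f i) hsum
      simp only [Finset.sum_apply, Pi.smul_apply, smul_eq_mul] at h
      rw [← h]
      refine Finset.sum_congr rfl fun l _ ↦ ?_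
      rw [hq l]
    rw [hzsum']
    simp_rw [hca, Finset.sum_smul, mul_smul]
    rw [Finset.sum_comm]
    refine Finset.sum_congr rfl fun l _ ↦ ?_
    rw [← Finset.smul_sum]
  -- S4: some `jj l` is not nilpotent
  have hex : ∃ l, ¬ IsNilpotent (jj l) := by
    by_contra hall
    push Not at hall
    have hcomm : ∀ l l', Commute (lam l • jj l) (lam l' • jj l') := fun l l' ↦ by
      refine (Commute.smul_right ?_ _).smul_left _
      exact (hjjc l' (jj l) (hjjA l))
    have hnil : IsNilpotent z := by
      rw [hzjj]
      exact Commute.isNilpotent_sum (fun l _ ↦ (hall l).smul (lam l)) fun l l' _ _ ↦ hcomm l l'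
    exact hz0 (IsIdempotentElem.eq_zero_of_isNilpotent hz2 hnil)
  obtain ⟨l, hl⟩ := hex
  -- the rational Fitting idempotent of `jj l`
  obtain ⟨P, hfid, hf0⟩ := stub_rationalFitting n X hX k (jj l) (hjjrp l) hl
  set f := Polynomial.aeval (jj l) ((Polynomial.X * P).map (algebraMap ℚ ℂ)) with hfdef
  set gP := Polynomial.aeval (jj l) (P.map (algebraMap ℚ ℂ)) with hgPdef
  have hfg : f = gP * jj l := by
    rw [hfdef, hgPdef, mul_comm Polynomial.X P, Polynomial.map_mul, Polynomial.map_X,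
      Polynomial.aeval_mul, Polynomial.aeval_X]
  have hfA : f ∈ 𝓐 := descent_aeval_mem (hjjA l) _
  have hfc : ∀ T ∈ 𝓐, T * f = f * T := fun T hT ↦ descent_commute_aeval (hjjc l T hT) _
  have hfrp : ∀ β, IsRationalClass β → IsRationalClass (f β) := descent_rp_aeval (hjjrp l) _
  have hfε : f * ε = f := by rw [hfg, mul_assoc, hjjε l]
  have hfe' : f e' = 0 := by rw [hfg, Module.End.mul_apply, hjje' l, map_zero]
  -- primitivity of `ε`
  rcases h5 f hfA hfid.eq hfc hfrp with h0 | hε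
  · exact absurd (hfε.symm.trans h0) hf0
  · -- `f = ε`, so `ε e' = 0`, i.e. `ε e = 0`
    have hfε' : f = ε := hfε.symm.trans hε
    rw [← hεe', ← hfε', hfe']
end Descent


/-- **Stub 4 (NEW, lead reshape R2; registered; PROVED here from Stubs 4a–4c) — THE STRONG SIEVE
GRANTED HODGE-TYPE STABILITY.** The planner's `stub_sieveKill` with the single extra hypothesis `hH`
(the Hecke algebra preserves the type `(n,n)`; in the line it is `heckeHodgeType`, from Stub 1): for a
ℚ-block `ε`, ONE ℂ-block `z ≤ ε` whose image avoids the type `(n,n)` makes `ε` kill every rational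
`(n,n)`-class. Strictly more than the sibling line's `stub_killedBarren` (which asks a killed conjugate
of EVERY ℂ-block below `ε`): the difference is the ℚ-descent lemma `rationalBlockDescent`.
[cite: BergeronMillsonMoeglin2016Balls, Part 2 §1.9 and Thm 61] -/
theorem stub_sieveKillOfHodgeStable :
    ∀ (m : ℕ) (X : SchemeOver ℂ) (D : UnitaryBallQuotientDatum (2 * (m + 1)) X), 1 ≤ m → m ≤ 2 →
      (∀ a ∈ Algebra.adjoin ℂ (Set.range (D.heckeCorrespondenceAction (2 * (m + 1)))),
        ∀ c : complexBetti X (2 * (m + 1)),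
          IsOfHodgeType (2 * (m + 1)) X (2 * (m + 1)) (m + 1) (m + 1) c →
            IsOfHodgeType (2 * (m + 1)) X (2 * (m + 1)) (m + 1) (m + 1) (a c)) →
      ∀ ε : Module.End ℂ (complexBetti X (2 * (m + 1))),
        ε ∈ Algebra.adjoin ℂ (Set.range (D.heckeCorrespondenceAction (2 * (m + 1)))) →
        ε * ε = ε →
        (∀ T ∈ Algebra.adjoin ℂ (Set.range (D.heckeCorrespondenceAction (2 * (m + 1)))), T * ε = ε * T) →
        (∀ β, IsRationalClass β → IsRationalClass (ε β)) →
        (∀ f ∈ Algebra.adjoin ℂ (Set.range (D.heckeCorrespondenceAction (2 * (m + 1)))), f * f = f →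
          (∀ T ∈ Algebra.adjoin ℂ (Set.range (D.heckeCorrespondenceAction (2 * (m + 1)))), T * f = f * T) →
          (∀ β, IsRationalClass β → IsRationalClass (f β)) → f * ε = 0 ∨ f * ε = ε) →
        ∀ z : Module.End ℂ (complexBetti X (2 * (m + 1))),
          z ∈ Algebra.adjoin ℂ (Set.range (D.heckeCorrespondenceAction (2 * (m + 1)))) →
          z * z = z →
          (∀ T ∈ Algebra.adjoin ℂ (Set.range (D.heckeCorrespondenceAction (2 * (m + 1)))), T * z = z * T) →
          z ≠ 0 →
          (∀ f ∈ Algebra.adjoin ℂ (Set.range (D.heckeCorrespondenceAction (2 * (m + 1)))), f * f = f →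
            (∀ T ∈ Algebra.adjoin ℂ (Set.range (D.heckeCorrespondenceAction (2 * (m + 1)))), T * f = f * T) →
            f * z = 0 ∨ f * z = z) →
          z * ε = z →
          (∃ T : Finset (ℕ × ℕ), (m + 1, m + 1) ∉ T ∧
            LinearMap.range z ≤ Submodule.span ℂ {c : complexBetti X (2 * (m + 1)) |
              ∃ pq ∈ T, IsOfHodgeType (2 * (m + 1)) X (2 * (m + 1)) pq.1 pq.2 c}) →
          ∀ e : complexBetti X (2 * (m + 1)), IsRationalClass e →
            IsOfHodgeType (2 * (m + 1)) X (2 * (m + 1)) (m + 1) (m + 1) e → ε e = 0 :=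
  fun _ _ D _ _ hH _ h1 h2 h3 h4 h5 _ hz1 hz2 hz3 hz0 _ hzε hT _ he he' ↦
    rationalBlockDescent D.isSmoothProjective D h1 h2 h3 h4 h5 hz1 hz2 hz3 hz0 hzε he
      (typeKill D.isSmoothProjective (hH _ hz1) hT he')

/-- **The planner's `stub_sieveKill`, now a theorem** (registered signature prefixed by an orientation
family with Poincaré duality): a ℂ-block `z ≤ ε` whose image avoids the type `(n,n)` kills every
`(n,n)`-class (`typeKill` with `heckeHodgeType`), in particular the rational one `e`; the ℚ-descent
lemma `rationalBlockDescent` transfers the kill to the ℚ-block `ε`. Rationality of `e` is consumed in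
the descent (Disproof F4 honoured). [cite: BergeronMillsonMoeglin2016Balls, Part 2 §1.9 and Thm 61] -/
theorem sieveKill (μ : OrientationFamily) (hμ : μ.HasPoincareDuality) :
    ∀ (m : ℕ) (X : SchemeOver ℂ) (D : UnitaryBallQuotientDatum (2 * (m + 1)) X), 1 ≤ m → m ≤ 2 →
      ∀ ε : Module.End ℂ (complexBetti X (2 * (m + 1))),
        ε ∈ Algebra.adjoin ℂ (Set.range (D.heckeCorrespondenceAction (2 * (m + 1)))) →
        ε * ε = ε →
        (∀ T ∈ Algebra.adjoin ℂ (Set.range (D.heckeCorrespondenceAction (2 * (m + 1)))), T * ε = ε * T) →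
        (∀ β, IsRationalClass β → IsRationalClass (ε β)) →
        (∀ f ∈ Algebra.adjoin ℂ (Set.range (D.heckeCorrespondenceAction (2 * (m + 1)))), f * f = f →
          (∀ T ∈ Algebra.adjoin ℂ (Set.range (D.heckeCorrespondenceAction (2 * (m + 1)))), T * f = f * T) →
          (∀ β, IsRationalClass β → IsRationalClass (f β)) → f * ε = 0 ∨ f * ε = ε) →
        ∀ z : Module.End ℂ (complexBetti X (2 * (m + 1))),
          z ∈ Algebra.adjoin ℂ (Set.range (D.heckeCorrespondenceAction (2 * (m + 1)))) →
          z * z = z →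
          (∀ T ∈ Algebra.adjoin ℂ (Set.range (D.heckeCorrespondenceAction (2 * (m + 1)))), T * z = z * T) →
          z ≠ 0 →
          (∀ f ∈ Algebra.adjoin ℂ (Set.range (D.heckeCorrespondenceAction (2 * (m + 1)))), f * f = f →
            (∀ T ∈ Algebra.adjoin ℂ (Set.range (D.heckeCorrespondenceAction (2 * (m + 1)))), T * f = f * T) →
            f * z = 0 ∨ f * z = z) →
          z * ε = z →
          (∃ T : Finset (ℕ × ℕ), (m + 1, m + 1) ∉ T ∧
            LinearMap.range z ≤ Submodule.span ℂ {c : complexBetti X (2 * (m + 1)) |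
              ∃ pq ∈ T, IsOfHodgeType (2 * (m + 1)) X (2 * (m + 1)) pq.1 pq.2 c}) →
          ∀ e : complexBetti X (2 * (m + 1)), IsRationalClass e →
            IsOfHodgeType (2 * (m + 1)) X (2 * (m + 1)) (m + 1) (m + 1) e → ε e = 0 :=
  fun m X D hm1 hm2 ↦ stub_sieveKillOfHodgeStable m X D hm1 hm2
    (fun _ ha c hc ↦ heckeHodgeType hμ D hm1 hm2 ha c hc)

/-! ## The card's lever composed: an impure ℚ-block kills `e` -/

/-- **An IMPURE ℚ-block kills every rational `(n,n)`-class `e ⊥ TW(D)`** — the statement registered as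
`stub_impureBarren` in the picked line, here DERIVED: `ε = Σ_{z ≤ ε} z` over the ℂ-blocks below it
(`exists_primitiveCentralIdempotents`, primitivity); `ε β ∉ H^{n,n}` for some `β` forces some `z ≤ ε`
with `z β ∉ H^{n,n}`; its exact archimedean data (Stub 3) make it, by `slotPurity_of_archData`, pure
(impossible), killed (Stub 4 ⟹ `ε e = 0`) or a tempered-type core (Stub 5 ⟹ `ε e = 0`).
[cite: arXiv:1306.1515, §5 and Thm 61] [cite: arXiv:1507.01432, Thm 1.1] -/
theorem impure_rationalBlock_apply_eq_zero (μ : OrientationFamily) (hμ : μ.HasPoincareDuality) {m : ℕ} {X : SchemeOver ℂ}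
    (D : UnitaryBallQuotientDatum (2 * (m + 1)) X) (hm1 : 1 ≤ m) (hm2 : m ≤ 2)
    {ε : Module.End ℂ (complexBetti X (2 * (m + 1)))}
    (h1 : ε ∈ Algebra.adjoin ℂ (Set.range (D.heckeCorrespondenceAction (2 * (m + 1)))))
    (h2 : ε * ε = ε)
    (h3 : ∀ T ∈ Algebra.adjoin ℂ (Set.range (D.heckeCorrespondenceAction (2 * (m + 1)))), T * ε = ε * T)
    (h4 : ∀ β, IsRationalClass β → IsRationalClass (ε β))
    (h5 : ∀ f ∈ Algebra.adjoin ℂ (Set.range (D.heckeCorrespondenceAction (2 * (m + 1)))), f * f = f →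
      (∀ T ∈ Algebra.adjoin ℂ (Set.range (D.heckeCorrespondenceAction (2 * (m + 1)))), T * f = f * T) →
      (∀ β, IsRationalClass β → IsRationalClass (f β)) → f * ε = 0 ∨ f * ε = ε)
    (himp : ∃ β, ¬ IsOfHodgeType (2 * (m + 1)) X (2 * (m + 1)) (m + 1) (m + 1) (ε β))
    {e : complexBetti X (2 * (m + 1))} (he : IsRationalClass e)
    (hH : IsOfHodgeType (2 * (m + 1)) X (2 * (m + 1)) (m + 1) (m + 1) e)
    (horth : ∀ x ∈ ((⨆ (W : Submodule D.E (Fin (2 * (m + 1) + 1) → D.E))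
        (_ : IsTotallyPositive (conjRingHom D.E) D.H W) (_ : Module.finrank D.E W = m + 1),
        classesSupportedOn X (D.specialSubvariety W) (2 * (m + 1))) ⊔
      (⨆ (W : Submodule D.E (Fin (2 * (m + 1) + 1) → D.E))
        (_ : IsTotallyPositive (conjRingHom D.E) D.H W) (_ : Module.finrank D.E W = m)
        (Z : Set X.left) (_ : IsClosed Z) (_ : Z ⊆ D.specialSubvariety W)
        (_ : ∀ z ∈ Z, ((m + 1 : ℕ) : ℕ∞) ≤ Order.coheight z),
        classesSupportedOn X Z (2 * (m + 1))) ⊔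
      Submodule.span ℂ {z : complexBetti X (2 * (m + 1)) |
        ∃ a : complexBetti X (2 * m), IsRationalClass a ∧
          IsOfHodgeType (2 * (m + 1)) X (2 * m) m m a ∧
          ∃ d ∈ algebraicClasses X 1,
            z = cupProduct (two_mul_add_two_mul m 1) a d}),
      cupProduct (two_mul_add_two_mul (m + 1) (m + 1)) e x = 0) :
    ε e = 0 := by
  classical
  have hH' := hH
  obtain ⟨A, -⟩ := hH'
  haveI := finite_complexBetti D.isSmoothProjective (2 * (m + 1))
  -- the ℂ-blocks of the Hecke algebra
  obtain ⟨t, ht, htsum⟩ := exists_primitiveCentralIdempotents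
    (Algebra.adjoin ℂ (Set.range (D.heckeCorrespondenceAction (2 * (m + 1)))))
  have hεz : ∀ z ∈ t, ε * z = 0 ∨ ε * z = z := fun z hz ↦ (ht z hz).2.2 ε ⟨h1, h2, h3⟩
  -- `ε` is the sum of the ℂ-blocks below it
  have hεsum : ∑ z ∈ t.filter (fun z ↦ ε * z = z), z = ε := by
    rw [Finset.sum_filter]
    calc ∑ z ∈ t, (if ε * z = z then z else 0) = ∑ z ∈ t, ε * z := by
          refine Finset.sum_congr rfl fun z hz ↦ ?_
          rcases hεz z hz with h0 | h0
          · have hne : ¬ ε * z = z := fun h ↦ (ht z hz).2.1 (h.symm.trans h0)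
            rw [if_neg hne, h0]
          · rw [if_pos h0, h0]
      _ = ε * ∑ z ∈ t, z := (Finset.mul_sum _ _ _).symm
      _ = ε := by rw [htsum, mul_one]
  -- some ℂ-block below `ε` is impure
  obtain ⟨β, hβ⟩ := himp
  have hex : ∃ z ∈ t.filter (fun z ↦ ε * z = z),
      ¬ IsOfHodgeType (2 * (m + 1)) X (2 * (m + 1)) (m + 1) (m + 1) (z β) := by
    by_contra hall
    push Not at hall
    apply hβ
    rw [← hεsum, LinearMap.sum_apply]
    exact IsOfHodgeType.sum D.isSmoothProjective A _
      (fun z : Module.End ℂ (complexBetti X (2 * (m + 1))) ↦ z β) hall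
  obtain ⟨z, hz, hzimp⟩ := hex
  obtain ⟨hzt, hεzz⟩ := Finset.mem_filter.1 hz
  obtain ⟨⟨hz1, hz2, hz3⟩, hz0, hzprim⟩ := ht z hzt
  have hzε : z * ε = z := by rw [h3 z hz1, hεzz]
  have hzprim' : ∀ f ∈ Algebra.adjoin ℂ (Set.range (D.heckeCorrespondenceAction (2 * (m + 1)))),
      f * f = f →
      (∀ T ∈ Algebra.adjoin ℂ (Set.range (D.heckeCorrespondenceAction (2 * (m + 1)))), T * f = f * T) →
      f * z = 0 ∨ f * z = z :=
    fun f hf hff hfc ↦ hzprim f ⟨hf, hff, hfc⟩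
  -- the dictionary and slot purity
  obtain ⟨r, b, S, hdata⟩ := archDictionary μ hμ m X D hm1 hm2 z hz1 hz2 hz3 hz0 hzprim'
  rcases slotPurity_of_archData D.isSmoothProjective A hm2 hdata with hpure | hkilled | hcore
  · exact absurd (hpure β) hzimp
  · exact sieveKill μ hμ m X D hm1 hm2 ε h1 h2 h3 h4 h5 z hz1 hz2 hz3 hz0 hzprim' hzε hkilled e he hH
  · exact stub_coreVanishingArch m X D hm1 hm2 ε h1 h2 h3 h4 h5 z hz1 hz2 hz3 hz0 hzprim' hzε
      ⟨r, b, S, hdata, hcore⟩ e he hH horth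

/-! ## The composition -/

/-- **The crux from the stubs** (line `middle-involution-purity`): with the ℚ-blocks `ε` of the Hecke
algebra (`rationalBlocks_landed`), each the action of an algebraic class `γ_ε` (`heckeGraphAlgebraic` +
`corrAlgebra_landed` + `stub_cupTriple`), the envelope of a rational `(n,n)`-class `e ⊥ TW(D)` is
`γ := Σ_{ε pure} γ_ε`: its action `Σ_{pure} ε` preserves rational classes, is `(n,n)`-valued, and fixes
`e` since `Σ_ε ε = 1` and the impure blocks kill `e` (`impure_rationalBlock_apply_eq_zero`: dictionary,
slot purity, sieve, core vanishing). [cite: arXiv:1306.1515, Thm 61 and §5] -/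
theorem OrthogonalEnveloped_of : OrthogonalEnveloped := by
  intro μ hμ m X D hm1 hm2 e he hH horth
  classical
  -- the ℚ-blocks of the Hecke algebra
  obtain ⟨s, hblk, -, hsum⟩ := rationalBlocks_landed m X D hm1 hm2
  -- the subalgebra of actions of algebraic self-correspondences contains the Hecke algebra
  obtain ⟨⟨δ, hδ, hδid⟩, hcomp⟩ :=
    corrAlgebra_landed μ hμ m X D.isSmoothProjective (stub_cupTriple m X D.isSmoothProjective)
  let S : Subalgebra ℂ (Module.End ℂ (complexBetti X (2 * (m + 1)))) :=
    { carrier := {T | ∃ γ ∈ algebraicClasses (X ⊗ X) (2 * (m + 1)),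
        corrAction μ D.isSmoothProjective D.isSmoothProjective
          (rfl : 2 * (m + 1) + 2 * (2 * (m + 1)) = 2 * (m + 1) + 2 * (2 * (m + 1))) γ = T}
      mul_mem' := by
        rintro _ _ ⟨γ, hγ, rfl⟩ ⟨γ', hγ', rfl⟩
        exact hcomp γ hγ γ' hγ'
      one_mem' := ⟨δ, hδ, hδid⟩
      add_mem' := by
        rintro _ _ ⟨γ, hγ, rfl⟩ ⟨γ', hγ', rfl⟩
        exact ⟨γ + γ', add_mem hγ hγ', map_add _ _ _⟩
      zero_mem' := ⟨0, zero_mem _, map_zero _⟩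
      algebraMap_mem' := fun c ↦ ⟨c • δ, Submodule.smul_mem _ c hδ, by
        rw [map_smul, hδid, Algebra.algebraMap_eq_smul_one]; rfl⟩ }
  have hle : Algebra.adjoin ℂ (Set.range (D.heckeCorrespondenceAction (2 * (m + 1)))) ≤ S := by
    refine Algebra.adjoin_le ?_
    rintro _ ⟨g, rfl⟩
    exact heckeGraphAlgebraic μ hμ m X D hm1 hm2 g
  -- each block is the action of an algebraic class
  have hεS : ∀ ε ∈ s, ∃ γ ∈ algebraicClasses (X ⊗ X) (2 * (m + 1)),
      corrAction μ D.isSmoothProjective D.isSmoothProjective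
        (rfl : 2 * (m + 1) + 2 * (2 * (m + 1)) = 2 * (m + 1) + 2 * (2 * (m + 1))) γ = ε :=
    fun ε hε ↦ hle (hblk ε hε).1
  choose! γf hγf hPγ using hεS
  -- the pure blocks and the envelope
  let pure : Module.End ℂ (complexBetti X (2 * (m + 1))) → Prop :=
    fun ε ↦ ∀ β, IsOfHodgeType (2 * (m + 1)) X (2 * (m + 1)) (m + 1) (m + 1) (ε β)
  have hP : corrAction μ D.isSmoothProjective D.isSmoothProjective
      (rfl : 2 * (m + 1) + 2 * (2 * (m + 1)) = 2 * (m + 1) + 2 * (2 * (m + 1)))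
      (∑ ε ∈ s.filter pure, γf ε) = ∑ ε ∈ s.filter pure, ε := by
    rw [map_sum]
    exact Finset.sum_congr rfl fun ε hε ↦ hPγ ε (Finset.mem_filter.1 hε).1
  refine ⟨∑ ε ∈ s.filter pure, γf ε,
    Submodule.sum_mem _ fun ε hε ↦ hγf ε (Finset.mem_filter.1 hε).1, ?_⟩
  intro P
  have hPβ : ∀ β, P β = ∑ ε ∈ s.filter pure, ε β := fun β ↦ by
    change corrAction μ D.isSmoothProjective D.isSmoothProjective
      (rfl : 2 * (m + 1) + 2 * (2 * (m + 1)) = 2 * (m + 1) + 2 * (2 * (m + 1)))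
      (∑ ε ∈ s.filter pure, γf ε) β = _
    rw [hP, LinearMap.sum_apply]
  refine ⟨fun β hβ ↦ ?_, fun β ↦ ?_, ?_⟩
  · -- rational classes are preserved: each block preserves them
    rw [hPβ]
    exact Finset.sum_induction _ (fun x ↦ IsRationalClass x) (fun a b ha hb ↦ ha.add hb)
      IsRationalClass.zero (fun ε hε ↦ (hblk ε (Finset.mem_filter.1 hε).1).2.2.2.1 β hβ)
  · -- the image is purely `(n,n)`: a sum of `(n,n)`-classes, tested in one Hodge model
    rw [hPβ]
    obtain ⟨A, -⟩ := hH
    rw [hodgePQ_independent_of_hodgeModel_holds.isOfHodgeType_iff D.isSmoothProjective A, map_sum]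
    exact Submodule.sum_mem _ fun ε hε ↦
      (hodgePQ_independent_of_hodgeModel_holds.isOfHodgeType_iff D.isSmoothProjective A).1
        ((Finset.mem_filter.1 hε).2 β)
  · -- `e` is fixed: `e = Σ_ε ε e` and the impure blocks kill `e`
    rw [hPβ]
    have he_sum : e = ∑ ε ∈ s, ε e := by
      conv_lhs => rw [show e = (∑ ε ∈ s, ε) e by rw [hsum]; rfl]
      rw [LinearMap.sum_apply]
    have hzero : ∑ ε ∈ s.filter (fun ε ↦ ¬ pure ε), ε e = 0 := by
      refine Finset.sum_eq_zero fun ε hε ↦ ?_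
      obtain ⟨hεs, hnp⟩ := Finset.mem_filter.1 hε
      obtain ⟨h1, h2, h3, h4, h5⟩ := hblk ε hεs
      exact impure_rationalBlock_apply_eq_zero μ hμ D hm1 hm2 h1 h2 h3 h4 h5 (not_forall.1 hnp) he hH horth
    conv_rhs => rw [he_sum, ← Finset.sum_filter_add_sum_filter_not s pure]
    rw [hzero, add_zero]

/-! ## Census instances (kernel-checked sanity of the vocabulary; card §First lemma) -/

/-- `N = 7`: blocks `(3,1,3)` — the centred member is `A(3,3)`; the member at `{3,2,1}` is impure in
degree `6` (type `(1,5)`); whether it shares `π_f` with `A(3,3)` is what the data `S` record. -/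
example : ajTypes ![3, 1, 3] 1 = {(3, 3)} ∧ ajTypes ![3, 1, 3] 0 = {(0, 4), (1, 5), (2, 6)} := by
  decide

/-- `N = 5`: blocks `(2,1,2)` = `ρ⊠R₂ ⊕ χ₀` — the non-DS members live in odd degrees only, so no
degree-`4` type besides `(2,2)`: `ajTypesOf` over ALL three blocks in degree `4` is `{(2,2)}`. -/
example : ajTypesOf ![2, 1, 2] Finset.univ 4 = {(2, 2)} := by
  decide

end Summit.HodgeConjecture.HodgeConjecture.Cruxes.OrthogonalEnveloped.MiddleInvolutionPurity

end
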